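import Summits.HubbardSuperconductivity.HubbardSuperconductivity.Theses.AposterioriCapRg
import Literature.MathematicalPhysics.QuantumLattice.GrassmannParity

/-!
# Disproof of `CapRgSymmetricCertificatePinned` (stmt-HubbardSuperconductivity-14045) — findings

Standing adversary file (refuter `cdisprove`; cycle 1 seat refuter-cdisprove-stmt-HubbardSuperconductivity-14045-0,
cycle 2 seat refuter-cdisprove-stmt-HubbardSuperconductivity-14045-g2-0, 2026-08-16).
VERDICT SO FAR: **no kill**.  The typed crux

  `∃ U ∈ [2,3], ∃ δ ∈ [1/5,7/20], ∃ μ, (GS density of hubbardTorusWith 2 (L+1) 1 U μ → 1-δ) ∧`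
  `∀ Θ, ∃ K Λ L₀, symmetricRegimeCertificateT U μ capRgCornerDataT Θ K Λ L₀`

is an existence claim about the INTERACTING countertermed cutoff effective action
`effAction ℂ C^K_{>Λ} (V + 𝒩_K)` at `U ∈ [2,3]` in the iterated limit `M → ∞, β → ∞, L → ∞`.  Every
clause is evaluated on that object; the only rigorous handles on it are exact identities and
symmetries, none of which contradicts the clauses.  What this file records, as checked Lean, is the
model-INDEPENDENT content of the clauses that any certificate must respect (boundary lemmas), the
exact SYMMETRY content of the model (cycle 2: a kernel-checked symmetry-transport engine for Salmhofer's
`e^{Δ_C}` calculus), the degenerate instances that are dead, and — as prose — the attacks that fail and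
WHY (for the provers).

## Checked content (all sorry-free; §1–§6 landed as Negative/SchurBound.lean p77238 and
## Negative/B1gBlind.lean p77885; §7 LANDED as Negative/GaugeCovariance.lean p83559; §8–§12 proposed as
## Negative/FreeFrame.lean, Negative/RotationCovariance.lean, Negative/OneSidedBlind.lean, Negative/SpinCovariance.lean,
## Negative/StonerCovariance.lean)

* §1 `re_neg_rayleigh_le_of_entry_bound`, `supRayleigh_neg_le_of_entry_bound` — Schur /
  Cauchy–Schwarz: `‖A i j‖ ≤ sᵢ C sⱼ ⇒ Re⟨v,-Av⟩ ≤ C Σ sᵢ²` for unit `v`, hence for the sup;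
  `pairingStrength_le_vertexSupNorm_mul`: **`λ_d ≤ ‖𝒱₄‖_∞ · Σ_{k∈S_Λ} (√ν_k)²`** for EVERY `G`.
* §2 `not_symmetricCertifiedAtT_of_cooperAmplitude_eq_zero` — no certificate when the Cooper
  amplitude vanishes on the shell.
* §3 `card_shell_lower_bound`, `card_shell_ge_of_certificateT`, `capRg_forces_fat_shells` — NECESSARY
  CONDITION: at any certified `(L, M, β)`, **`|S_Λ(L)| ≥ ΛL²/32`** at `π₀`.
* §4–§5 `rot_odd_of_isB1g`, `sum_sqrt_mul_eq_zero_of_rot_odd`, **`pairingStrength_le_of_amplitude_sub_const_le`**: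
  under (ii′)-Cooper and `C₄` covariance of band and BCS weight, **`λ_d ≤ sup_{S×S} ‖𝒞 - c‖ · Σ_{S} (√ν)²`
  for EVERY constant `c`** (the `B₁g` bottom is blind to the constant part of the Cooper amplitude; the
  whole first order `+U` certifies nothing).
* §6 `not_cooperDominance_one`, `not_symmetricCertifiedAtT_one`, `not_symmetricRegimeHoldsT_from_one` — the
  `1 × 1` torus carries no `B₁g` unit vector: `L₀ ≥ 2` is forced.
* §7 (cycle 2) **SYMMETRY TRANSPORT ENGINE** for `GrassmannLaplacian`/`GrassmannEffectiveAction` (generic `R`, `Γ`):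
  `grassmannDeriv_map` (`∂_X (f_* a) = f_* ((e_X^* ∘ f) ⌋ a)` for every linear substitution), `constPart_map`,
  `map_grassmannLog1p`; Laplacian-commuting substitutions commute with `μ_C ⋆ = e^{Δ_C}` and FIX the effective
  action of invariant interactions (`gaussConv_map_of_comm`, `map_effAction_eq_self_of_comm`); two instances —
  DIAGONAL SCALINGS `diagScale c` (gauge transformations: `kernel_map_diagScale`, `Δ_C ∘ c_* = c_* ∘ Δ_{cCc}`,
  `map_diagScale_effAction`, selection rule `kernel_eq_zero_of_map_diagScale_eq`) and RELABELLINGS `relabel σ`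
  (`kernel_map_relabel`, `Δ_C ∘ σ_* = σ_* ∘ Δ_{C∘(σ×σ)}`, `map_relabel_effAction`, covariance of kernels
  `kernel_comp_perm_of_map_relabel_eq`).  Provers: this is the tool to reduce the CAP's label sets by the exact
  symmetries; here it is used destructively.
* §8 (cycle 2) **NO CERTIFICATE AT `U = 0` IN ANY FRAME** — the general-frame junk test left open in
  `SymmetricRegimeCertificate.lean` ("only the bare-frame case is proved here"): the zero-seed CT covariance is
  mode-diagonal (`hubbardCovAboveCT_zero_seed_eq_zero`), preserved by every single-mode gauge scaling
  `modeGauge m₀ t` (`ψ^±_{m₀} ↦ t^{±1} ψ^±_{m₀}`), as is the counterterm `𝒩_K`; so the free CT action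
  `hubbardEffectiveActionCT L M β 0 μ 0 K Λ` is `U(1)^{modes}`-invariant (`map_modeGauge_hubbardEffectiveActionCT_free`)
  and its Cooper amplitude is DIAGONAL (`cooperAmplitude_free_eq_zero_of_ne`); and **a shell-diagonal Cooper
  amplitude certifies nothing** for ANY `G` (`not_symmetricCertifiedAtT_of_cooperAmplitude_offDiag_eq_zero`:
  the `B₁g` bottom `f` and its modulus `|f|` — unit, orthogonal to `f` by rotation-oddness — have the same
  Rayleigh quotient, so margin `2` forces `λ_d ≤ 0`).  Hence `not_symmetricRegimeCertificateT_free_frame`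
  (`¬ symmetricRegimeCertificateT 0 μ π Θ K Λ L₀`, all `μ π Θ K Λ L₀`) and the crux-level `_false_without_` form
  `capRg_certificateHalf_false_at_free` (the certificate half `∀ Θ ∃ K Λ L₀ …` is false at `U = 0`): **the
  hypothesis `U ∈ [2,3]` is load-bearing through the quartic vertex itself — moving the frame cannot
  manufacture the window.**
* §8 C′ (cycle 2) **PARITY**: `𝒢^K_Λ` is even for every `U`, seed and frame (`map_parity_hubbardEffectiveActionCT`, the
  scaling `c ≡ -1` in §7), so odd vertex functions and their sup norms vanish
  (`vertexSupNorm_hubbardCT_eq_zero_of_odd`): clause (i′b) at `m_max = 10` charges exactly `‖𝒱₆‖, ‖𝒱₈‖, ‖𝒱₁₀‖`.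
* §9 (cycle 2) **`C₄` COVARIANCE OF THE MODEL, UNCONDITIONAL**: the rotation by `π/2` on labels (`rotLabel`)
  preserves the zero-seed CT covariance of every frame (`hubbardCovAboveCT_rotLabel`: band, frame and cutoff
  are rotation invariant on the dual torus), the Hubbard vertex and the counterterm; hence
  `hubbardEffectiveActionCT L M β U μ 0 K Λ` is rotation invariant for EVERY `U`
  (`map_rotLabel_hubbardEffectiveActionCT`) and so are `Σ`, `z`, `ν`, and `𝒞(rot k, rot k') = 𝒞(k, k')`
  (`selfEnergy_/fieldStrength_/bcsMeasure_/cooperAmplitude_hubbardCT_rotSite`).  This DISCHARGES `he`, `hν` of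
  §5 for the model (`pairingStrength_hubbardCT_le_of_amplitude_sub_const_le`) and gives the **OSCILLATION
  NECESSARY CONDITION** `cooperAmplitude_osc_lower_bound` / `cooperAmplitude_osc_of_certificateT`: at every
  certified `(L, M, β)` and for EVERY `c ∈ ℂ`, `sup_{S_Λ×S_Λ} ‖𝒞 - c‖ ≥ ΛL²/(8|S_Λ|)` at `π₀` — the certified
  interacting Cooper amplitude at `Λ*` is quantitatively NOT shell-constant (physically `≥ (1/8)/Σν ≈ 0.66`
  inside the sup budget `E₁ = 4`, versus second-order Kohn–Luttinger `≈ 0.23`: the CAP lives on a genuinely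
  non-perturbative momentum structure of `𝒱₄`).

* §10 (cycle 2) **ONE-SIDED BLINDNESS** (`pairingStrength_le_of_amplitude_sub_oneSided_le`, any `G` with rotation-invariant band
  and BCS weight; model form `pairingStrength_hubbardCT_le_of_amplitude_sub_oneSided_le`): under (ii′)-Cooper,
  `λ_d ≤ sup_{S×S} ‖𝒞 - Q₁ - Q₂‖ · Σ_S (√ν)²` for ALL kernels `Q₁` rotation-invariant in `k⃗` and `Q₂` rotation-invariant in
  `k⃗'` — containing constants (§5) and every additively separable `g(k⃗) + h(k⃗')`
  (`not_symmetricCertifiedAtT_of_cooperAmplitude_additive`); necessary condition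
  `cooperAmplitude_oneSided_dist_of_certificateT`: the certified `𝒞` is at sup-distance `≥ ΛL²/(8|S_Λ|)` from that whole
  linear space.  Forward-scattering-like and one-leg-averaged amplitudes certify nothing; only genuinely two-sided
  `B₁g ⊗ B₁g` structure (e.g. a transfer-dependent exchange `V(k⃗ - k⃗')`) can carry the window.
  §10′: inversion covariance of `Σ`, `z`, `𝒞` (`cooperAmplitude_hubbardCT_neg_neg`) and `ν(k⃗) = 1/(2ΛL² z(k⃗))`.
* §11 (cycle 2) **SPIN-FLIP COVARIANCE** (`map_spinFlip_hubbardEffectiveActionCT`, every `U`, frame, scale; the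
  zero-seed Nambu table has `G(-k)₁₁ = -G(k)₀₀`, the two even pairs of the Hubbard vertex commute): `Σ` and `z`
  do not depend on the spin (`selfEnergy_hubbardCT_spin`, `fieldStrengthSpin_hubbardCT_spin`,
  `fieldStrength_hubbardCT_eq_spin`) — clauses (0b′), (0c) need ONE spin — and the Cooper amplitude equals its
  spin-exchanged form (`cooperAmplitude_hubbardCT_spinFlip`).
* §12 (cycle 2) **STONER CLAUSE COVARIANCE**: `supRayleigh_submatrix_equiv` (top Rayleigh quotient invariant under a
  simultaneous row/column permutation); particle–hole vertices, scale-`Λ` bubble and transfer shell of the model are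
  rotation covariant, the Stoner matrices at `rot q⃗` are the `rot`-reindexed ones, so `st^{c,s}(rot q⃗) = st^{c,s}(q⃗)`
  (`stonerCharge_/stonerSpin_hubbardCT_rotSite`): clause (ii′)-Stoner needs certifying on a fundamental domain of
  transfers only.

## Attacks that FAIL, and why the crux resists (prover briefing)

A1 vacuity of `∀ Θ`: `SymmetricTolerance` carries `0 < c₀`, `0 < w`.  A2 `U = 0`: outside `[2,3]`; now dead
   in EVERY frame (§8), not only `K = 0`.
A3 TREE-LEVEL REDUCIBLE LEGS.  `‖𝒱₄‖_∞` is a sup over ALL labels, including fully integrated ones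
   (`w = 1`).  There `G₄ = Γ₄ · Π_legs D/(D + wΣ₁)`, `D = -iω + e_K`, `Σ₁` the 1PI self-energy of the cutoff
   theory INCLUDING `+K`.  At tree level in `U` (`Σ₁ = K`) the leg factor is `(-iω+e_K)/(-iω+ξ)`, singular on
   the FREE Fermi curve, so `‖𝒱₄‖_∞ → ∞` as `β → ∞` ORDER BY ORDER at fixed `K ≠ 0`.  Not a kill: with
   `K ≈ -Re Σ_int` (what (0b′) enforces) the dressed dispersion of the cutoff theory is `≈ e_K`, whose zero set
   lies INSIDE the protected region `w = 0`.  Lesson: (i′a) is a statement about RESUMMED legs; the CAP must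
   carry the self-energy non-perturbatively from the first scale.
A4 CROSSING IDENTITY (`β → ∞`): Cooper amplitude and `L_{↑↓}(k,-k′; q = k′-k)` are one function at zero
   frequency; Stoner bounds the TOP of `√χ Γ √χ`, `λ_d` is the BOTTOM of `√ν 𝒞 √ν` — no sign-definite link.
   (§7's engine makes the exact statement "same kernel at permuted labels" available: `kernel` is the
   antisymmetric coefficient, `vertexFn` at a permuted tuple is `sgn` times the value.)
A5 SCHUR (§1) and `B₁g`-blind (§5, now unconditional §9): necessary conditions, consistent.
A6 FRAME / μ-CONVENTION (rattack-14045, refuted-MISSTATED, repaired `C′` reads the certificate at `μ - U/2`):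
   symmetric Matsubara sums put the Grassmann model at operator-`μ + U/2`; at the corner the certificate then
   concerns the particle–hole MIRROR filling `≈ 1.2` of `0.8` (`μ_H(0.8) ≈ U/4`), as plausible as intended;
   elsewhere in the box the mirror filling is `≈ 0.92–1.13`, near half filling, where (0d) `d_vH ≥ 1/2` is
   delicate — but nothing about the interacting density `n(μ, U)` is provable at `U ∈ [2,3]` (no convergent
   expansion at `T = 0`), so the ∃(U, δ, μ) cannot be cornered rigorously.  Does NOT make the typed `S` false.
A7 (0c) VERSUS (0b′), one-mode pole analysis: `𝒢₂ = rD/(D + wr)` ⇒ `z = 1 + w r²/((e_K + wr)² + ω₀²)`; the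
   ceiling `z ≤ 2` and (0b′) jointly keep `e_K + w r` away from `0` on the partially integrated annulus
   `Λ/2 < |e_K| ≤ Λ` (the shell is NOT all protected: `w = χ₂(e²/Λ²) > 0` there).  Informative, consistent.
A8 LIMITS.  `M → ∞`: loop sums converge symmetrically (tadpole = midpoint, A6).  `β → ∞` at fixed `L`:
   integrated lines gapped by `≥ Λ/2`; `λ_d(L)` has `O(1/L)` Riemann-sum oscillation ⇒ `L₀ ≳ C/w`, allowed.
   CORRECTION to cycle 1 / rattack §4 ("∀c₀ ⇒ an exact FST counterterm in the closure of the `coeffNorm₄ ≤ 10`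
   ball"): `TrigPolyC4v` has FINITE degree, so the weighted-`ℓ¹` ball is NOT compact inside the type; its
   closure (where the exact counterterm of the `Λ*`-cutoff theory would live) consists of infinite cosine
   series.  `∀ c₀` therefore asks, for each `c₀`, for a finite-degree `K` with `Σ(1+m+n)⁴|κ_{mn}|` ≤ 10 matching
   `-Re Σ^{Λ}(0,·)` on `{e_K = 0}` within `c₀Λ` — costs: `(1,0)` harmonic ×16, `(1,1)` ×81, `(2,0)` ×81,
   `(2,1)` ×256 per unit amplitude, constant ×1 (Hartree `≈ U n/2 ≈ 1.2–1.8`).  Feasible iff the exact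
   counterterm's weighted norm is `< 10` with slack; a quantitative, unprovable-either-way condition.
A9 `B₁g` EXISTENCE: dead only at `L = 1` (§6).
A10 `Z ≠ 0 ∀ M ≥ M₀`: at fixed `(L, β)` the cutoff partition function `Z_{>Λ}(U)` has an `M → ∞` limit which is
   real-analytic in `β` and entire in `U` (the below-scale covariance `C_{≤Λ}` has finite frequency support at
   fixed `(L, β)`, so `Z_{>Λ}` is a finite-dimensional free-fermion expectation of a polynomial insertion);
   it is REAL but carries no positivity (no OS positivity with a soft frequency cutoff).  A zero of
   `β ↦ Z_{>Λ}(β)` beyond `β₀` would blow up `𝒱₄ = O(1/Z)` and break (i′a) at that `β` — but nothing forces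
   such zeros; the certifier's `∃ β₀` cannot dodge them if they accumulate at `β = ∞`, and nobody can compute
   them at `U = 3`.  Open, recorded for the provers: **(0a)+(i′a) uniformly in `β ≥ β₀` is a genuine claim about
   the large-`β` sign structure of a non-positive Grassmann normaliser.**
A11 ORDER-BY-ORDER `λ_d`: one-loop `≈ 0.06 < 1/8` at `Λ* = 1/100` — numerics, no theorem.
A12 (cycle 2) GAUGE / SELECTION RULES at `U > 0`: the Hubbard vertex breaks `U(1)^{modes}` to global charge,
   `S^z`, momentum and frequency conservation; every clause's label set (self-energy, Cooper, particle–hole)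
   is conserving, so §7's selection rule kills nothing at `U > 0`.  Exact zeros from antisymmetry: only at
   REPEATED labels (e.g. `L_{σσ}(k,k;0) = 0`, so `Γ^s(0;k,k) = -Γ^c(0;k,k)`): no clause is hit.
A13 (cycle 2) `C₄`, inversion, spin flip, `SU(2)`, complex conjugation: all are symmetries of `𝒢^K_Λ` at `h = 0`
   (rotation checked in §9; the others go through §7 verbatim — spin flip needs `G(-k)₁₁ = -G(k)₀₀` of the
   zero-seed Nambu table).  They STRUCTURE the certificate (B₁g sector, singlet/triplet split, reality) but
   contradict no clause: CooperDominance asks for a simple `B₁g` bottom, which no symmetry forbids for `L ≥ 2`.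
A14 (cycle 2) CONTINUUM (0d) `ShellGeometry`: purely classical; the curvature floor `κ₁ > 0` excludes open
   (non-contractible) Fermi curves and inflection points, the `d_vH` clause excludes the saddles — all met by a
   convex electron/hole pocket, which `K`'s free constant `|κ₀₀| ≤ 10` can always place; (0d) alone never
   fails, and its link to the physical filling runs through (0b′) and the uncomputable interacting `Σ`.
A15 (cycle 2) CHANNEL COMPETITION (margin `2` of (ii′)): asymptotically exact weak coupling (Raghu–Kivelson–
   Scalapino 2010) and the BCS-regime diagrammatics of Deng–Kozik–Prokof'ev–Svistunov 2015 (both in the item's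
   sources; quoted from memory — `lit search` was down, rc 75, when this was written) have `d_{x²-y²}` dominant
   close to half filling at `t′ = 0`, with `p` / `d_{xy}` channels competing or winning at lower density
   (Deng 2015 report a triplet `p`-wave window around `n ≈ 0.6–0.75` at `U ≲ 4`).  So inside the typed box a
   simple `B₁g` bottom with margin `2` is plausible only toward `δ = 1/5` (`n = 0.8`) — or, after A6's shift, at
   the mirror fillings `≈ 0.9–1.2` — and `∃ δ` lets the certifier choose; no printed result contradicts it, none
   proves it.  (Qin et al. 2020, absence of SC in the pure model, is `U = 6–8`, `δ = 1/8`: strong coupling, not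
   this crux.)

## Targets
(none yet: no line picked, `payload.targets = []`, `stuck_stubs = []`.)

## Near-misses
None kept as `sorry`: every candidate `¬`-statement needs a quantitative fact about the interacting
action at `U ∈ [2,3]` (A3, A8, A10, A11) that no printed theorem supplies (printed radii `|U| ≲ 10⁻²`).
-/

noncomputable section

set_option linter.dupNamespace false

namespace Summit.HubbardSuperconductivity.HubbardSuperconductivity.Cruxes.CapRgSymmetricCertificatePinned.Disproof

open Literature.MathematicalPhysics.QuantumLattice Literature.Probability.LatticeModels GrassmannAlgebra Finset Matrix
open scoped BigOperators ComplexConjugate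

/-! ## §1 The Schur bound: clause (iii′) is dominated by clause (i′a) times the BCS shell mass -/

section Schur

variable {m : Type*} [Fintype m]

/-- A `dotProduct`-unit vector has `Σ ‖vᵢ‖² = 1`. [folklore] -/
theorem sum_norm_sq_eq_one_of_unit {v : m → ℂ} (hv : star v ⬝ᵥ v = 1) : ∑ i, ‖v i‖ ^ 2 = 1 := by
  have h := congrArg Complex.re hv
  simp only [dotProduct, Pi.star_apply, Complex.star_def, Complex.conj_mul', Complex.re_sum,
    Complex.one_re] at h
  simpa [← Complex.ofReal_pow, Complex.ofReal_re] using h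

/-- **Schur / Cauchy–Schwarz bound, pointwise.**  If `‖A i j‖ ≤ sᵢ · C · sⱼ` with `C ≥ 0`, then the
Rayleigh quotient of `-A` at every `dotProduct`-unit vector is at most `C Σᵢ sᵢ²`. [folklore] -/
theorem re_neg_rayleigh_le_of_entry_bound (A : Matrix m m ℂ) (s : m → ℝ) (C : ℝ)
    (hC : 0 ≤ C) (hA : ∀ i j, ‖A i j‖ ≤ s i * C * s j) {v : m → ℂ} (hv : star v ⬝ᵥ v = 1) :
    (star v ⬝ᵥ ((-A) *ᵥ v)).re ≤ C * ∑ i, s i ^ 2 := by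
  have step1 : ‖star v ⬝ᵥ ((-A) *ᵥ v)‖ ≤ ∑ i, ‖v i‖ * ∑ j, ‖A i j‖ * ‖v j‖ := by
    unfold dotProduct
    refine (norm_sum_le _ _).trans (Finset.sum_le_sum fun i _ => ?_)
    rw [norm_mul, Pi.star_apply, norm_star]
    refine mul_le_mul_of_nonneg_left ?_ (norm_nonneg _)
    simp only [Matrix.mulVec, dotProduct, Matrix.neg_apply]
    refine (norm_sum_le _ _).trans (Finset.sum_le_sum fun j _ => ?_)
    rw [norm_mul, norm_neg]
  have step2 : ∑ i, ‖v i‖ * ∑ j, ‖A i j‖ * ‖v j‖ ≤ ∑ i, ‖v i‖ * ∑ j, (s i * C * s j) * ‖v j‖ := by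
    gcongr with i _ j _
    exact hA i j
  have step3 : ∑ i, ‖v i‖ * ∑ j, (s i * C * s j) * ‖v j‖ = C * (∑ i, s i * ‖v i‖) ^ 2 := by
    rw [sq, Finset.sum_mul_sum, Finset.mul_sum]
    refine Finset.sum_congr rfl fun i _ => ?_
    rw [Finset.mul_sum, Finset.mul_sum]
    refine Finset.sum_congr rfl fun j _ => ?_
    ring
  have step4 : (∑ i, s i * ‖v i‖) ^ 2 ≤ (∑ i, s i ^ 2) * ∑ i, ‖v i‖ ^ 2 :=
    Finset.sum_mul_sq_le_sq_mul_sq _ _ _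
  rw [sum_norm_sq_eq_one_of_unit hv, mul_one] at step4
  calc (star v ⬝ᵥ ((-A) *ᵥ v)).re ≤ ‖star v ⬝ᵥ ((-A) *ᵥ v)‖ := Complex.re_le_norm _
    _ ≤ C * (∑ i, s i * ‖v i‖) ^ 2 := by rw [← step3]; exact step1.trans step2
    _ ≤ C * ∑ i, s i ^ 2 := mul_le_mul_of_nonneg_left step4 hC

/-- **Schur / Cauchy–Schwarz bound.**  If `‖A i j‖ ≤ sᵢ · C · sⱼ` with `C ≥ 0`, then
`supRayleigh (-A) ≤ C Σᵢ sᵢ²` (junk `0` on an empty index type included). [folklore] -/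
theorem supRayleigh_neg_le_of_entry_bound (A : Matrix m m ℂ) (s : m → ℝ) (C : ℝ)
    (hC : 0 ≤ C) (hA : ∀ i j, ‖A i j‖ ≤ s i * C * s j) :
    (-A).supRayleigh ≤ C * ∑ i, s i ^ 2 := by
  have hrhs : 0 ≤ C * ∑ i, s i ^ 2 := mul_nonneg hC (Finset.sum_nonneg fun i _ => sq_nonneg _)
  unfold Matrix.supRayleigh
  rcases isEmpty_or_nonempty {v : m → ℂ // star v ⬝ᵥ v = 1} with h | h
  · rw [Real.iSup_of_isEmpty]; exact hrhs
  · exact ciSup_le fun v => re_neg_rayleigh_le_of_entry_bound A s C hC hA v.2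

/-- `Σᵢ sᵢ² = Σ_{i∈S} (√wᵢ)²` for the indicator-weighted square root `sᵢ = 𝟙_S(i) √wᵢ`. [folklore] -/
theorem sum_indicator_sqrt_sq [DecidableEq m] (S : Finset m) (w : m → ℝ) :
    ∑ i, (fun j => if j ∈ S then Real.sqrt (w j) else 0) i ^ 2 = ∑ i ∈ S, Real.sqrt (w i) ^ 2 := by
  have : ∀ i, (fun j => if j ∈ S then Real.sqrt (w j) else 0) i ^ 2 =
      if i ∈ S then Real.sqrt (w i) ^ 2 else 0 := fun i => by
    by_cases hi : i ∈ S
    · simp only [if_pos hi]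
    · simp only [if_neg hi]; ring
  simp_rw [this]
  rw [Finset.sum_ite, Finset.sum_const_zero, add_zero, Finset.filter_mem_eq_inter, Finset.univ_inter]

omit [Fintype m] in
/-- **Entry bound of a sandwiched kernel**: if `‖F k k′‖ ≤ C` on `S × S` then the matrix
`𝟙_S(k)𝟙_S(k′) √w_k F(k,k′) √w_{k′}` has entries bounded by `s_k C s_{k′}`, `s = 𝟙_S √w`. [folklore] -/
theorem norm_sandwich_le [DecidableEq m] {S : Finset m} {w : m → ℝ} {F : m → m → ℂ} {C : ℝ}
    (hF : ∀ k ∈ S, ∀ k' ∈ S, ‖F k k'‖ ≤ C) (k k' : m) :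
    ‖(if k ∈ S ∧ k' ∈ S then ((Real.sqrt (w k) : ℝ) : ℂ) * F k k' * ((Real.sqrt (w k') : ℝ) : ℂ) else 0)‖ ≤
      (fun j => if j ∈ S then Real.sqrt (w j) else 0) k * C *
        (fun j => if j ∈ S then Real.sqrt (w j) else 0) k' := by
  simp only []
  by_cases hk : k ∈ S
  · by_cases hk' : k' ∈ S
    · rw [if_pos ⟨hk, hk'⟩, if_pos hk, if_pos hk', norm_mul, norm_mul,
        Complex.norm_real, Complex.norm_real, Real.norm_eq_abs, Real.norm_eq_abs,
        abs_of_nonneg (Real.sqrt_nonneg _), abs_of_nonneg (Real.sqrt_nonneg _)]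
      exact mul_le_mul_of_nonneg_right (mul_le_mul_of_nonneg_left (hF k hk k' hk') (Real.sqrt_nonneg _))
        (Real.sqrt_nonneg _)
    · rw [if_neg (fun h => hk' h.2), if_pos hk, if_neg hk', norm_zero, mul_zero]
  · rw [if_neg (fun h => hk h.1), if_neg hk, norm_zero, zero_mul, zero_mul]

end Schur

section Cooper

variable {L M : ℕ} [NeZero L] [NeZero M]

/-- **`λ_d ≤ C · Σ_{k ∈ S_Λ} (√ν_k)²` whenever `|𝒞(k,k′)| ≤ C` on `S_Λ × S_Λ`** (any `G`, any band, any
scale; `(√ν)² = ν` where `ν ≥ 0`, `= 0` where the BCS measure is negative junk). [folklore] -/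
theorem pairingStrength_le_of_amplitude_le (β Λ : ℝ) (e : TorusSite 2 L → ℝ) (G : HubbardGrassmann L M)
    {C : ℝ} (hC : 0 ≤ C)
    (hamp : ∀ k ∈ momentumShell L e Λ, ∀ k' ∈ momentumShell L e Λ, ‖cooperAmplitude L M β G k k'‖ ≤ C) :
    pairingStrength L M β e Λ G ≤
      C * ∑ k ∈ momentumShell L e Λ, Real.sqrt (bcsMeasure L M β Λ G k) ^ 2 := by
  classical
  have hA : ∀ k k', ‖cooperMatrix L M β e Λ G k k'‖ ≤
      (fun j => if j ∈ momentumShell L e Λ then Real.sqrt (bcsMeasure L M β Λ G j) else 0) k * C *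
        (fun j => if j ∈ momentumShell L e Λ then Real.sqrt (bcsMeasure L M β Λ G j) else 0) k' := fun k k' => by
    rw [cooperMatrix, Matrix.of_apply]
    convert norm_sandwich_le (S := momentumShell L e Λ) (w := bcsMeasure L M β Λ G)
      (F := cooperAmplitude L M β G) hamp k k' using 3
  rw [pairingStrength, ← sum_indicator_sqrt_sq]
  exact supRayleigh_neg_le_of_entry_bound _ _ C hC hA

/-- **`λ_d ≤ ‖𝒱₄‖_∞ · Σ_{k∈S_Λ} (√ν_k)²`** for every effective action `G`: the pairing strength (clause
(iii′)) is dominated by the quartic sup norm (clause (i′a)) times the BCS shell mass. [folklore] -/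
theorem pairingStrength_le_vertexSupNorm_mul (β Λ : ℝ) (e : TorusSite 2 L → ℝ) (G : HubbardGrassmann L M) :
    pairingStrength L M β e Λ G ≤
      vertexSupNorm L M β G 4 * ∑ k ∈ momentumShell L e Λ, Real.sqrt (bcsMeasure L M β Λ G k) ^ 2 :=
  pairingStrength_le_of_amplitude_le β Λ e G (vertexSupNorm_nonneg L M β G 4) fun k _ k' _ => by
    unfold cooperAmplitude
    exact norm_vertexFn_le_vertexSupNorm L M β G 4 _

/-! ## §2 No Cooper amplitude on the shell ⇒ no certificate (any data, any `a > 0`) -/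

/-- If the Cooper amplitude vanishes on `S_Λ × S_Λ` then `λ_d ≤ 0`, so no interval with `a > 0`
certifies `G` — whatever the other clauses say.  (Every purely quadratic `G` is of this kind.) [folklore] -/
theorem not_symmetricCertifiedAtT_of_cooperAmplitude_eq_zero {π : SymmetricRegimeDataT}
    {Θ : SymmetricTolerance} {a b : ℚ} (ha : 0 < a) {Λ β : ℝ} {e : TorusSite 2 L → ℝ}
    {G : HubbardGrassmann L M} {Z : ℂ}
    (h0 : ∀ k ∈ momentumShell L e Λ, ∀ k' ∈ momentumShell L e Λ, cooperAmplitude L M β G k k' = 0) :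
    ¬ SymmetricCertifiedAtT π Θ a b Λ L M β e G Z := by
  intro h
  have h1 := h.window.1
  have h2 := pairingStrength_le_of_amplitude_le β Λ e G (le_refl (0 : ℝ))
    (fun k hk k' hk' => by rw [h0 k hk k' hk', norm_zero])
  rw [zero_mul] at h2
  have : (0 : ℝ) < a := by exact_mod_cast ha
  linarith

/-! ## §3 Certified shells are fat: `|S_Λ(L)| ≥ a · 2ζ · Λ L² / E₁` (`≥ ΛL²/32` at `π₀`) -/

/-- Under the field-strength floor `ζ ≤ z(±k)` the BCS measure is in `[0, 1/(2ζΛL²)]`. [folklore] -/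
theorem bcsMeasure_mem_of_fieldStrength {β Λ ζ : ℝ} (hΛ : 0 < Λ) (hζ : 0 < ζ) {G : HubbardGrassmann L M}
    {k : TorusSite 2 L} (hk : ζ ≤ fieldStrength L M β G k) (hk' : ζ ≤ fieldStrength L M β G (-k)) :
    0 ≤ bcsMeasure L M β Λ G k ∧ bcsMeasure L M β Λ G k ≤ 1 / (2 * ζ * Λ * (L : ℝ) ^ 2) := by
  have hL : (0 : ℝ) < (L : ℝ) ^ 2 := pow_pos (by exact_mod_cast NeZero.pos L) 2
  have hz : 2 * ζ ≤ fieldStrength L M β G k + fieldStrength L M β G (-k) := by linarith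
  have hpos : 0 < Λ * (L : ℝ) ^ 2 * (fieldStrength L M β G k + fieldStrength L M β G (-k)) :=
    mul_pos (mul_pos hΛ hL) (by linarith)
  refine ⟨by unfold bcsMeasure; positivity, ?_⟩
  unfold bcsMeasure
  rw [show 2 * ζ * Λ * (L : ℝ) ^ 2 = Λ * (L : ℝ) ^ 2 * (2 * ζ) by ring]
  exact one_div_le_one_div_of_le (by positivity) (mul_le_mul_of_nonneg_left hz (by positivity))

/-- **Fat-shell necessary condition (point form).**  A certificate at `(L, M, β)` for an EVEN band
forces `a · (2ζ Λ L²) ≤ E₁ · |S_Λ|`: `a ≤ λ_d ≤ ‖𝒱₄‖_∞ Σ_{S} ν ≤ E₁ |S| /(2ζΛL²)`. [folklore] -/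
theorem card_shell_lower_bound {π : SymmetricRegimeDataT} {Θ : SymmetricTolerance} {a b : ℚ}
    {Λ β : ℝ} {e : TorusSite 2 L → ℝ} {G : HubbardGrassmann L M} {Z : ℂ}
    (h : SymmetricCertifiedAtT π Θ a b Λ L M β e G Z) (he : ∀ k, e (-k) = e k) (hΛ : 0 < Λ) :
    (a : ℝ) * (2 * π.fieldFloor * Λ * (L : ℝ) ^ 2) ≤ π.quarticBound * (momentumShell L e Λ).card := by
  set S := momentumShell L e Λ
  have hζ : (0 : ℝ) < π.fieldFloor := by exact_mod_cast π.fieldFloor_pos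
  have hz : ∀ k ∈ S, (π.fieldFloor : ℝ) ≤ fieldStrength L M β G k := fun k hk => by
    have h0 := (h.fieldStrength_mem hk 0).1
    have h1 := (h.fieldStrength_mem hk 1).1
    unfold fieldStrength
    linarith
  have hneg : ∀ k ∈ S, -k ∈ S := fun k hk => by
    rw [mem_momentumShell] at hk ⊢
    rwa [he]
  have hν : ∀ k ∈ S, Real.sqrt (bcsMeasure L M β Λ G k) ^ 2 ≤ 1 / (2 * π.fieldFloor * Λ * (L : ℝ) ^ 2) := by
    intro k hk
    obtain ⟨h0, h1⟩ := bcsMeasure_mem_of_fieldStrength hΛ hζ (hz k hk) (hz (-k) (hneg k hk))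
    rw [Real.sq_sqrt h0]
    exact h1
  have hsum : ∑ k ∈ S, Real.sqrt (bcsMeasure L M β Λ G k) ^ 2 ≤
      S.card * (1 / (2 * π.fieldFloor * Λ * (L : ℝ) ^ 2)) :=
    (Finset.sum_le_sum hν).trans (by rw [Finset.sum_const, nsmul_eq_mul])
  have hE : (0 : ℝ) ≤ π.quarticBound := by exact_mod_cast π.quarticBound_pos.le
  have hchain : (a : ℝ) ≤ π.quarticBound * (S.card * (1 / (2 * π.fieldFloor * Λ * (L : ℝ) ^ 2))) :=
    calc (a : ℝ) ≤ pairingStrength L M β e Λ G := h.window.1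
      _ ≤ vertexSupNorm L M β G 4 * ∑ k ∈ S, Real.sqrt (bcsMeasure L M β Λ G k) ^ 2 :=
        pairingStrength_le_vertexSupNorm_mul β Λ e G
      _ ≤ π.quarticBound * ∑ k ∈ S, Real.sqrt (bcsMeasure L M β Λ G k) ^ 2 :=
        mul_le_mul_of_nonneg_right h.quartic_le (Finset.sum_nonneg fun k _ => sq_nonneg _)
      _ ≤ π.quarticBound * (S.card * (1 / (2 * π.fieldFloor * Λ * (L : ℝ) ^ 2))) :=
        mul_le_mul_of_nonneg_left hsum hE
  have hD : 0 < 2 * (π.fieldFloor : ℝ) * Λ * (L : ℝ) ^ 2 := by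
    have hL : (0 : ℝ) < (L : ℝ) ^ 2 := pow_pos (by exact_mod_cast NeZero.pos L) 2
    positivity
  rw [show (π.quarticBound : ℝ) * (S.card * (1 / (2 * π.fieldFloor * Λ * (L : ℝ) ^ 2))) =
      π.quarticBound * S.card / (2 * π.fieldFloor * Λ * (L : ℝ) ^ 2) by ring] at hchain
  exact (le_div_iff₀ hD).1 hchain

/-- **Fat-shell necessary condition for the model at the pinned data `π₀`.**  If
`symmetricRegimeCertificateT U μ capRgCornerDataT Θ K Λ L₀` holds then for EVERY `L ≥ L₀` the
discrete shell `{k ∈ (ℤ/Lℤ)² : |e_K(k)| ≤ Λ}` has at least `Λ L²/32` points (`a ≥ 1/8`, `ζ = 1/2`,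
`E₁ = 4`; the shell does not depend on `β, M`, so one certified `(β, M)` per `L` suffices). [folklore] -/
theorem card_shell_ge_of_certificateT {U μ : ℝ} {Θ : SymmetricTolerance} {K : TrigPolyC4v} {Λ : ℝ}
    {L₀ : ℕ} (h : symmetricRegimeCertificateT U μ capRgCornerDataT Θ K Λ L₀) :
    ∀ L : ℕ, L₀ ≤ L → ∀ [NeZero L],
      Λ * (L : ℝ) ^ 2 / 32 ≤ ((momentumShell L (nambuXiCT L μ K) Λ).card : ℝ) := by
  intro L hL _
  obtain ⟨-, hΛ, -, a, b, ha, -, -, -, hblock⟩ := h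
  obtain ⟨β₀, hβ₀⟩ := hblock L hL
  obtain ⟨M₀, hM₀⟩ := hβ₀ β₀ le_rfl
  haveI : NeZero (M₀ + 1) := ⟨Nat.succ_ne_zero _⟩
  have hc := hM₀ (M₀ + 1) (Nat.le_succ _)
  have key := card_shell_lower_bound hc (fun k => nambuXiCT_neg L μ K k) hΛ.pos
  have hf : ((capRgCornerDataT.fieldFloor : ℚ) : ℝ) = 1 / 2 := by
    rw [capRgCornerDataT_bounds.2.2.1]; norm_num
  have hq : ((capRgCornerDataT.quarticBound : ℚ) : ℝ) = 4 := by
    rw [capRgCornerDataT_bounds.1]; norm_num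
  rw [hf, hq] at key
  have ha' : (1 / 8 : ℝ) ≤ a := by
    have := (Rat.cast_le (K := ℝ)).2 ha
    simpa [symmetricWindowLower] using this
  have hΛL : 0 ≤ Λ * (L : ℝ) ^ 2 := mul_nonneg hΛ.pos.le (sq_nonneg _)
  nlinarith

/-- **Crux-level form**: `CapRgSymmetricCertificatePinned` hands, for every tolerance, a frame and a
scale whose shells are eventually fat. (Necessary condition; physically met with room — recorded so that
no prover tries a certificate with a starved shell, e.g. `Λ L₀² < 32`.) [folklore] -/
theorem capRg_forces_fat_shells
    (h : Summit.HubbardSuperconductivity.HubbardSuperconductivity.Theses.AposterioriCapRg.CapRgSymmetricCertificatePinned) :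
    ∃ U ∈ Set.Icc (2:ℝ) 3, ∃ μ : ℝ, ∀ Θ : SymmetricTolerance, ∃ (K : TrigPolyC4v) (Λ : ℝ) (L₀ : ℕ),
      0 < Λ ∧ ∀ L : ℕ, L₀ ≤ L → ∀ [NeZero L],
        Λ * (L : ℝ) ^ 2 / 32 ≤ ((momentumShell L (nambuXiCT L μ K) Λ).card : ℝ) := by
  obtain ⟨U, hU, δ, -, μ, -, hcert⟩ := h
  refine ⟨U, hU, μ, fun Θ => ?_⟩
  obtain ⟨K, Λ, L₀, hc⟩ := hcert Θ
  exact ⟨K, Λ, L₀, hc.scale_pos, card_shell_ge_of_certificateT hc⟩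

end Cooper

/-! ## §4 `D₄` bookkeeping: the rotation by `π/2` -/

section Rot

variable {L : ℕ}

/-- `χ_{B₁g}(r) = -1` for the rotation by `π/2`. [folklore] -/
theorem b1gChar_r_one : b1gChar (DihedralGroup.r 1) = -1 := by
  simp only [b1gChar]
  rw [show (1 : ZMod 4).val = 1 by decide]
  norm_num

/-- `d4Site r = rotSite`. [folklore] -/
theorem d4Site_r_one (k : TorusSite 2 L) : d4Site (DihedralGroup.r 1) k = rotSite k := by
  simp only [d4Site]
  rw [show (1 : ZMod 4).val = 1 by decide, Function.iterate_one]

/-- A `B₁g` function is odd under the rotation by `π/2`. [folklore] -/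
theorem rot_odd_of_isB1g {f : TorusSite 2 L → ℂ} (hf : IsB1g f) (k : TorusSite 2 L) :
    f (rotSite k) = -f k := by
  have h := hf (DihedralGroup.r 1) k
  rw [d4Site_r_one, b1gChar_r_one] at h
  rw [h]; ring

/-- **Rotation-odd functions are `ℓ²(S, √ν)`-orthogonal to constants**: for a rotation-invariant
finite set `S` and weight `ν`, `f ∘ rot = -f` gives `Σ_{k∈S} √ν_k f_k = 0`. [folklore] -/
theorem sum_sqrt_mul_eq_zero_of_rot_odd [NeZero L] (S : Finset (TorusSite 2 L)) (ν : TorusSite 2 L → ℝ)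
    (f : TorusSite 2 L → ℂ) (hS : ∀ k, rotSite k ∈ S ↔ k ∈ S) (hν : ∀ k, ν (rotSite k) = ν k)
    (hf : ∀ k, f (rotSite k) = -f k) :
    ∑ k ∈ S, ((Real.sqrt (ν k) : ℝ) : ℂ) * f k = 0 := by
  classical
  let t : TorusSite 2 L → ℂ := fun k => if k ∈ S then ((Real.sqrt (ν k) : ℝ) : ℂ) * f k else 0
  have ht : ∀ k, t k = if k ∈ S then ((Real.sqrt (ν k) : ℝ) : ℂ) * f k else 0 := fun k => rfl
  have hT : ∑ k ∈ S, ((Real.sqrt (ν k) : ℝ) : ℂ) * f k = ∑ k, t k := by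
    simp_rw [ht]
    rw [Finset.sum_ite_mem, Finset.univ_inter]
  -- the rotation by `π/2` as a permutation of the dual torus
  let ρ : TorusSite 2 L ≃ TorusSite 2 L :=
    { toFun := rotSite
      invFun := fun x => ![x 1, -x 0]
      left_inv := fun x => by ext i; fin_cases i <;> simp [rotSite]
      right_inv := fun x => by ext i; fin_cases i <;> simp [rotSite] }
  have hrot : ∑ k, t (rotSite k) = ∑ k, t k := Equiv.sum_comp ρ t
  have hodd : ∀ k, t (rotSite k) = -t k := fun k => by
    rw [ht, ht k]
    simp only [hS k, hν k, hf k]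
    split_ifs <;> ring
  have hsum : ∑ k, t k = -∑ k, t k :=
    calc ∑ k, t k = ∑ k, t (rotSite k) := hrot.symm
      _ = ∑ k, -t k := Finset.sum_congr rfl fun k _ => hodd k
      _ = -∑ k, t k := Finset.sum_neg_distrib _
  have h2 : (2 : ℂ) * ∑ k, t k = 0 := by linear_combination hsum
  rw [hT]
  simpa using h2

end Rot

/-! ## §5 The `B₁g` bottom is blind to the constant part of the Cooper amplitude -/

section Blind

variable {L M : ℕ} [NeZero L] [NeZero M]

/-- **The `B₁g` bottom is blind to constants.**  Under clause (ii′)-Cooper (`CooperDominance`), with a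
rotation-invariant band and BCS weight (the `C₄ᵥ` covariance every frame-`K` Hubbard action has;
hypotheses `he`, `hν`), for EVERY constant `c : ℂ`:

  `λ_d ≤ (sup_{S_Λ×S_Λ} ‖𝒞 - c‖) · Σ_{k∈S_Λ} (√ν_k)²`.

So the momentum-INDEPENDENT part of the Cooper amplitude — in particular the whole first order `+U` —
certifies nothing: the window `λ_d ≥ 1/8` of clause (iii′) must be carried by the momentum dependence
of the scale-`Λ*` Cooper amplitude alone (physically `Σν ≈ 0.19`, so an oscillation `≥ 0.66` over
`S_Λ × S_Λ` inside the sup-norm budget `E₁ = 4`). [folklore] -/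
theorem pairingStrength_le_of_amplitude_sub_const_le (β Λ : ℝ) (e : TorusSite 2 L → ℝ)
    (G : HubbardGrassmann L M) (hdom : CooperDominance (cooperMatrix L M β e Λ G))
    (he : ∀ k, e (rotSite k) = e k)
    (hν : ∀ k, bcsMeasure L M β Λ G (rotSite k) = bcsMeasure L M β Λ G k)
    (c : ℂ) {C : ℝ} (hC : 0 ≤ C)
    (hamp : ∀ k ∈ momentumShell L e Λ, ∀ k' ∈ momentumShell L e Λ,
      ‖cooperAmplitude L M β G k k' - c‖ ≤ C) :
    pairingStrength L M β e Λ G ≤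
      C * ∑ k ∈ momentumShell L e Λ, Real.sqrt (bcsMeasure L M β Λ G k) ^ 2 := by
  classical
  obtain ⟨f, hf1, hB, hbottom, -⟩ := hdom
  -- abbreviations
  have hSrot : ∀ k, rotSite k ∈ momentumShell L e Λ ↔ k ∈ momentumShell L e Λ := fun k => by
    simp only [mem_momentumShell, he]
  -- the constant part of the Cooper matrix annihilates `f`
  have hT : ∑ k ∈ momentumShell L e Λ, ((Real.sqrt (bcsMeasure L M β Λ G k) : ℝ) : ℂ) * f k = 0 :=
    sum_sqrt_mul_eq_zero_of_rot_odd _ _ f hSrot hν (rot_odd_of_isB1g hB)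
  let Atil : Matrix (TorusSite 2 L) (TorusSite 2 L) ℂ := Matrix.of fun k k' =>
    if k ∈ momentumShell L e Λ ∧ k' ∈ momentumShell L e Λ then
      ((Real.sqrt (bcsMeasure L M β Λ G k) : ℝ) : ℂ) * (cooperAmplitude L M β G k k' - c) *
        ((Real.sqrt (bcsMeasure L M β Λ G k') : ℝ) : ℂ)
    else 0
  let P : Matrix (TorusSite 2 L) (TorusSite 2 L) ℂ := Matrix.of fun k k' =>
    if k ∈ momentumShell L e Λ ∧ k' ∈ momentumShell L e Λ then
      ((Real.sqrt (bcsMeasure L M β Λ G k) : ℝ) : ℂ) * c * ((Real.sqrt (bcsMeasure L M β Λ G k') : ℝ) : ℂ)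
    else 0
  have hsplit : cooperMatrix L M β e Λ G = Atil + P := by
    ext k k'
    simp only [cooperMatrix, Matrix.of_apply, Matrix.add_apply, Atil, P]
    split_ifs <;> ring
  have hPf : P *ᵥ f = 0 := by
    ext k
    simp only [Matrix.mulVec, dotProduct, Matrix.of_apply, Pi.zero_apply, P]
    by_cases hk : k ∈ momentumShell L e Λ
    · have : ∀ k', (if k ∈ momentumShell L e Λ ∧ k' ∈ momentumShell L e Λ then
            ((Real.sqrt (bcsMeasure L M β Λ G k) : ℝ) : ℂ) * c *
              ((Real.sqrt (bcsMeasure L M β Λ G k') : ℝ) : ℂ) else 0) * f k' =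
          ((Real.sqrt (bcsMeasure L M β Λ G k) : ℝ) : ℂ) * c *
            (if k' ∈ momentumShell L e Λ then ((Real.sqrt (bcsMeasure L M β Λ G k') : ℝ) : ℂ) * f k' else 0) :=
        fun k' => by
          by_cases hk' : k' ∈ momentumShell L e Λ
          · rw [if_pos ⟨hk, hk'⟩, if_pos hk']; ring
          · rw [if_neg (fun h => hk' h.2), if_neg hk']; ring
      simp_rw [this]
      rw [← Finset.mul_sum, Finset.sum_ite_mem, Finset.univ_inter, hT, mul_zero]
    · refine Finset.sum_eq_zero fun k' _ => ?_
      rw [if_neg (fun h => hk h.1), zero_mul]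
  have hre : reRayleigh (cooperMatrix L M β e Λ G) f = (star f ⬝ᵥ (Atil *ᵥ f)).re := by
    rw [reRayleigh, hsplit, Matrix.add_mulVec, hPf, add_zero]
  have hA : ∀ k k', ‖Atil k k'‖ ≤
      (fun j => if j ∈ momentumShell L e Λ then Real.sqrt (bcsMeasure L M β Λ G j) else 0) k * C *
        (fun j => if j ∈ momentumShell L e Λ then Real.sqrt (bcsMeasure L M β Λ G j) else 0) k' := fun k k' => by
    simp only [Atil, Matrix.of_apply]
    convert norm_sandwich_le (S := momentumShell L e Λ) (w := bcsMeasure L M β Λ G)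
      (F := fun k k' => cooperAmplitude L M β G k k' - c) hamp k k' using 3
  have key := re_neg_rayleigh_le_of_entry_bound Atil _ C hC hA hf1
  rw [Matrix.neg_mulVec, dotProduct_neg, Complex.neg_re, sum_indicator_sqrt_sq] at key
  have hlam : pairingStrength L M β e Λ G = -reRayleigh (cooperMatrix L M β e Λ G) f := by
    rw [hbottom, neg_neg, pairingStrength]
  rw [hlam, hre]
  exact key

/-- **Corollary (first order certifies nothing).**  If the Cooper amplitude is CONSTANT on the shell
(e.g. the bare `+U` of `hubbardInteraction`), a `C₄ᵥ`-covariant `G` with Cooper dominance has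
`λ_d ≤ 0`; hence no certificate with `a > 0`. [folklore] -/
theorem not_symmetricCertifiedAtT_of_cooperAmplitude_const {π : SymmetricRegimeDataT}
    {Θ : SymmetricTolerance} {a b : ℚ} (ha : 0 < a) {Λ β : ℝ} {e : TorusSite 2 L → ℝ}
    {G : HubbardGrassmann L M} {Z : ℂ} (c : ℂ)
    (he : ∀ k, e (rotSite k) = e k)
    (hν : ∀ k, bcsMeasure L M β Λ G (rotSite k) = bcsMeasure L M β Λ G k)
    (hconst : ∀ k ∈ momentumShell L e Λ, ∀ k' ∈ momentumShell L e Λ, cooperAmplitude L M β G k k' = c) :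
    ¬ SymmetricCertifiedAtT π Θ a b Λ L M β e G Z := by
  intro h
  have h1 := h.window.1
  have h2 := pairingStrength_le_of_amplitude_sub_const_le β Λ e G h.cooperDominance he hν c (le_refl (0:ℝ))
    (fun k hk k' hk' => by rw [hconst k hk k' hk', sub_self, norm_zero])
  rw [zero_mul] at h2
  have : (0 : ℝ) < a := by exact_mod_cast ha
  linarith

end Blind

/-! ## §6 The `1 × 1` torus is never certified: no `B₁g` unit vector -/

section SmallTorus

/-- On the `1 × 1` torus every `B₁g` function vanishes (each site is fixed by the rotation `r`,
`χ_{B₁g}(r) = -1`), so it is not a unit vector. [folklore] -/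
theorem star_dotProduct_eq_zero_of_isB1g_one (f : TorusSite 2 1 → ℂ) (hf : IsB1g f) : star f ⬝ᵥ f = 0 := by
  have hzero : ∀ k, f k = 0 := fun k => by
    have h := rot_odd_of_isB1g hf k
    rw [show rotSite k = k from Subsingleton.elim _ _] at h
    have h2 : (2 : ℂ) * f k = 0 := by linear_combination h
    simpa using h2
  simp [dotProduct, hzero]

/-- No matrix on the `1 × 1` torus has `B₁g` Cooper dominance. [folklore] -/
theorem not_cooperDominance_one (A : Matrix (TorusSite 2 1) (TorusSite 2 1) ℂ) : ¬ CooperDominance A := by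
  rintro ⟨f, hf1, hB, -, -⟩
  rw [star_dotProduct_eq_zero_of_isB1g_one f hB] at hf1
  exact zero_ne_one hf1

/-- **The natural strengthening "`∀ L ≥ 1`" of the certificate is false**: at `L = 1` clause (ii′)
fails for EVERY effective action, data, tolerance, interval, scale and normaliser. [folklore] -/
theorem not_symmetricCertifiedAtT_one (π : SymmetricRegimeDataT) (Θ : SymmetricTolerance) (a b : ℚ)
    (Λ : ℝ) (M : ℕ) [NeZero M] (β : ℝ) (e : TorusSite 2 1 → ℝ) (G : HubbardGrassmann 1 M) (Z : ℂ) :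
    ¬ SymmetricCertifiedAtT π Θ a b Λ 1 M β e G Z := fun h =>
  not_cooperDominance_one _ h.cooperDominance

/-- Hence no model family is `T`-certified from `L₀ = 1` with the threshold actually used at `L = 1`:
`SymmetricRegimeHoldsT … 1 …` forces `L₀ = 1 ≤ 1` to be certified — contradiction.  (So every
certificate has `L₀ ≥ 2`; the crux's `∃ L₀` is load-bearing, if only trivially.) [folklore] -/
theorem not_symmetricRegimeHoldsT_from_one (π : SymmetricRegimeDataT) (Θ : SymmetricTolerance) (n : ℝ)
    (eC : (Fin 2 → ℝ) → ℝ) (Λ : ℝ) (e : ∀ (L : ℕ) [NeZero L], TorusSite 2 L → ℝ)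
    (G : ∀ (L M : ℕ) [NeZero L], ℝ → HubbardGrassmann L M) (Z : ∀ (L M : ℕ) [NeZero L], ℝ → ℂ) :
    ¬ SymmetricRegimeHoldsT π Θ n eC Λ 1 e G Z := by
  intro h
  obtain ⟨a, b, -, -, -, hblock⟩ := h.exists_window
  obtain ⟨β₀, hβ₀⟩ := hblock 1 le_rfl
  obtain ⟨M₀, hM₀⟩ := hβ₀ β₀ le_rfl
  haveI : NeZero (M₀ + 1) := ⟨Nat.succ_ne_zero _⟩
  exact not_symmetricCertifiedAtT_one π Θ a b Λ (M₀ + 1) β₀ (e 1) (G 1 (M₀ + 1) β₀) (Z 1 (M₀ + 1) β₀)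
    (hM₀ (M₀ + 1) (Nat.le_succ _))

end SmallTorus


/-! ## §7 (cycle 2) Symmetry transport, A1: Substitution versus derivative, constant part, `exp` and `log` -/

section Subst

variable (R : Type*) [CommRing R] {Γ : Type*}

/-- **Derivative versus substitution**: for a linear substitution `f` of the generator space,
`∂_X (f_* a) = f_* (d_{e_X ∘ f} ⌋ a)` (contraction by the pulled-back coordinate form). [folklore] -/
theorem grassmannDeriv_map (f : (Γ → R) →ₗ[R] (Γ → R)) (X : Γ) (a : GrassmannAlgebra R Γ) :
    grassmannDeriv R X (ExteriorAlgebra.map f a) =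
      ExteriorAlgebra.map f (CliffordAlgebra.contractLeft ((LinearMap.proj X).comp f) a) := by
  induction a using CliffordAlgebra.left_induction with
  | algebraMap r =>
    rw [AlgHom.commutes, grassmannDeriv_algebraMap, CliffordAlgebra.contractLeft_algebraMap, map_zero]
  | add x y hx hy => rw [map_add, map_add, hx, hy, map_add, map_add]
  | ι_mul x m hx =>
    rw [map_mul (ExteriorAlgebra.map f), CliffordAlgebra.contractLeft_ι_mul, map_sub (ExteriorAlgebra.map f),
      map_smul (ExteriorAlgebra.map f), map_mul (ExteriorAlgebra.map f)]
    erw [ExteriorAlgebra.map_apply_ι]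
    rw [grassmannDeriv_ι_mul, hx, LinearMap.comp_apply, LinearMap.proj_apply]

/-- The constant part is invariant under substitutions. [folklore] -/
theorem constPart_map (f : (Γ → R) →ₗ[R] (Γ → R)) (a : GrassmannAlgebra R Γ) :
    constPart R (ExteriorAlgebra.map f a) = constPart R a := by
  have h : (constPart R (Γ := Γ)).comp (ExteriorAlgebra.map f) = constPart R (Γ := Γ) := by
    refine ExteriorAlgebra.hom_ext ?_
    refine LinearMap.ext fun v => ?_
    simp only [LinearMap.comp_apply, AlgHom.toLinearMap_apply, AlgHom.comp_apply,
      ExteriorAlgebra.map_apply_ι, constPart_ι]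
  exact congrArg (fun φ : GrassmannAlgebra R Γ →ₐ[R] R => φ a) h

variable [Algebra ℚ R]

/-- Substitutions commute with the nilpotent exponential. [folklore] -/
theorem map_grassmannExp' (f : (Γ → R) →ₗ[R] (Γ → R)) {a : GrassmannAlgebra R Γ} (ha : IsNilpotent a) :
    ExteriorAlgebra.map f (grassmannExp a) = grassmannExp (ExteriorAlgebra.map f a) :=
  IsNilpotent.map_exp ha _

/-- Substitutions commute with the truncated logarithm (nilpotent argument). [folklore] -/
theorem map_grassmannLog1p (f : (Γ → R) →ₗ[R] (Γ → R)) {x : GrassmannAlgebra R Γ} (hx : IsNilpotent x) :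
    ExteriorAlgebra.map f (grassmannLog1p R x) = grassmannLog1p R (ExteriorAlgebra.map f x) := by
  have hm : x ^ nilpotencyClass x = 0 := pow_nilpotencyClass hx
  have hm' : (ExteriorAlgebra.map f x) ^ nilpotencyClass x = 0 := by rw [← map_pow, hm, map_zero]
  rw [grassmannLog1p_eq_sum R hm', grassmannLog1p, map_sum]
  refine Finset.sum_congr rfl fun k _ => ?_
  rw [map_rat_smul, map_pow]

/-- The truncated logarithm of a non-nilpotent element is the junk value `0`. [folklore] -/
theorem grassmannLog1p_of_not_isNilpotent {y : GrassmannAlgebra R Γ} (hn : ¬ IsNilpotent y) :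
    grassmannLog1p R y = 0 := by
  rw [grassmannLog1p, nilpotencyClass, Nat.sInf_eq_zero.2 (Or.inr ?_), Finset.range_zero, Finset.sum_empty]
  ext k
  exact ⟨fun hk => hn ⟨k, hk⟩, fun h => h.elim⟩

end Subst

/-! ## §7 A2: Laplacian-commuting substitutions commute with `μ_C ⋆` and fix the effective action -/

section Comm

variable (R : Type*) [CommRing R] [Algebra ℚ R] {Γ : Type*} [Fintype Γ]

/-- If `Δ_C` commutes with `f_*`, so do its powers. [folklore] -/
theorem grassmannLaplacian_pow_map_of_comm {C : Matrix Γ Γ R} {f : (Γ → R) →ₗ[R] (Γ → R)}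
    (hf : ∀ a, grassmannLaplacian R C (ExteriorAlgebra.map f a) = ExteriorAlgebra.map f (grassmannLaplacian R C a))
    (k : ℕ) (a : GrassmannAlgebra R Γ) :
    (grassmannLaplacian R C ^ k) (ExteriorAlgebra.map f a) = ExteriorAlgebra.map f ((grassmannLaplacian R C ^ k) a) := by
  induction k with
  | zero => simp
  | succ k ih => rw [pow_succ', Module.End.mul_apply, ih, hf, Module.End.mul_apply]

/-- **A Laplacian-commuting substitution commutes with the Gaussian convolution** `μ_C ⋆ = e^{Δ_C}`.
[folklore] -/
theorem gaussConv_map_of_comm {C : Matrix Γ Γ R} {f : (Γ → R) →ₗ[R] (Γ → R)}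
    (hf : ∀ a, grassmannLaplacian R C (ExteriorAlgebra.map f a) = ExteriorAlgebra.map f (grassmannLaplacian R C a))
    (a : GrassmannAlgebra R Γ) :
    gaussConv R C (ExteriorAlgebra.map f a) = ExteriorAlgebra.map f (gaussConv R C a) := by
  obtain ⟨k, hk⟩ := isNilpotent_grassmannLaplacian R C
  rw [gaussConv, IsNilpotent.exp_eq_sum hk, LinearMap.coe_sum, Finset.sum_apply, Finset.sum_apply, map_sum]
  refine Finset.sum_congr rfl fun i _ => ?_
  rw [LinearMap.smul_apply, LinearMap.smul_apply, grassmannLaplacian_pow_map_of_comm R hf, map_rat_smul]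

/-- **A Laplacian-commuting substitution fixes the effective action of every invariant nilpotent
interaction**: `f_* (effAction C V) = effAction C V`. [folklore] -/
theorem map_effAction_eq_self_of_comm {C : Matrix Γ Γ R} {f : (Γ → R) →ₗ[R] (Γ → R)}
    (hf : ∀ a, grassmannLaplacian R C (ExteriorAlgebra.map f a) = ExteriorAlgebra.map f (grassmannLaplacian R C a))
    {V : GrassmannAlgebra R Γ} (hV : IsNilpotent V) (hinv : ExteriorAlgebra.map f V = V) :
    ExteriorAlgebra.map f (effAction R C V) = effAction R C V := by
  have hB : ExteriorAlgebra.map f (effBoltzmann R C V) = effBoltzmann R C V := by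
    rw [effBoltzmann, ← gaussConv_map_of_comm R hf, map_grassmannExp' R _ hV.neg, map_neg, hinv]
  set y := Ring.inverse (effPartitionFn R C V) • effBoltzmann R C V - 1 with hy
  have hy' : ExteriorAlgebra.map f y = y := by
    rw [hy, map_sub, map_smul, hB, map_one]
  rw [effAction, map_neg]
  congr 1
  by_cases hn : IsNilpotent y
  · rw [map_grassmannLog1p R _ hn, hy']
  · rw [grassmannLog1p_of_not_isNilpotent R hn, map_zero]

end Comm

/-! ## §7 A3: Diagonal scalings (gauge transformations) -/

section Diag

variable (R : Type*) [CommRing R] {Γ : Type*}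

/-- The **diagonal scaling** `v ↦ (X ↦ c_X v_X)` of the generator space (`ψ(X) ↦ c_X ψ(X)`). [folklore] -/
def diagScale (c : Γ → R) : (Γ → R) →ₗ[R] (Γ → R) :=
  LinearMap.pi fun X => c X • (LinearMap.proj X : (Γ → R) →ₗ[R] R)

/-- `(c · v)_X = c_X v_X`. [folklore] -/
theorem diagScale_apply (c : Γ → R) (v : Γ → R) (X : Γ) : diagScale R c v X = c X * v X := by
  simp [diagScale]

/-- The coordinate form pulls back to a multiple of itself: `e_X^* ∘ c = c_X e_X^*`. [folklore] -/
theorem proj_comp_diagScale (c : Γ → R) (X : Γ) :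
    (LinearMap.proj X : (Γ → R) →ₗ[R] R).comp (diagScale R c) = c X • (LinearMap.proj X) := by
  refine LinearMap.ext fun v => ?_
  simp [diagScale_apply]

/-- The scaling on a basis vector. [folklore] -/
theorem diagScale_single [DecidableEq Γ] (c : Γ → R) (Y : Γ) :
    diagScale R c (Pi.single Y 1) = c Y • (Pi.single Y 1 : Γ → R) := by
  ext X
  rw [diagScale_apply, Pi.smul_apply, smul_eq_mul, Pi.single_apply]
  split_ifs with h
  · subst h; ring
  · ring

/-- `(c)_* ψ(Y) = c_Y ψ(Y)`. [folklore] -/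
theorem map_diagScale_gen [DecidableEq Γ] (c : Γ → R) (Y : Γ) :
    ExteriorAlgebra.map (diagScale R c) (gen R Y) = c Y • gen R Y := by
  rw [gen, ExteriorAlgebra.map_apply_ι, diagScale_single, map_smul]

/-- `∂_X ((c)_* a) = c_X · (c)_* (∂_X a)`. [folklore] -/
theorem grassmannDeriv_map_diagScale (c : Γ → R) (X : Γ) (a : GrassmannAlgebra R Γ) :
    grassmannDeriv R X (ExteriorAlgebra.map (diagScale R c) a) =
      c X • ExteriorAlgebra.map (diagScale R c) (grassmannDeriv R X a) := by
  rw [grassmannDeriv_map, proj_comp_diagScale, map_smul, LinearMap.smul_apply, map_smul]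
  rfl

variable [Algebra ℚ R]

omit [Algebra ℚ R] in
/-- Iterated derivatives versus the diagonal scaling: `∂_X ((c)_* a) = (∏ c_{X_i}) · (c)_* (∂_X a)`.
[folklore] -/
theorem iterDeriv_map_diagScale (c : Γ → R) {m : ℕ} (X : Fin m → Γ) (a : GrassmannAlgebra R Γ) :
    iterDeriv R X (ExteriorAlgebra.map (diagScale R c) a) =
      (∏ i, c (X i)) • ExteriorAlgebra.map (diagScale R c) (iterDeriv R X a) := by
  induction m with
  | zero => simp [iterDeriv]
  | succ m ih =>
    have hsplit : ∀ b : GrassmannAlgebra R Γ, iterDeriv R X b =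
        grassmannDeriv R (X (Fin.last m)) (iterDeriv R (fun i => X i.castSucc) b) := fun b => by
      simp only [iterDeriv, List.ofFn_succ', List.concat_eq_append, List.reverse_append,
        List.reverse_singleton, List.singleton_append, List.prod_cons, Module.End.mul_apply]
    rw [hsplit, ih, map_smul, grassmannDeriv_map_diagScale, smul_smul, hsplit, Fin.prod_univ_castSucc,
      mul_comm]

/-- **Kernels scale**: `kernel ((c)_* F) m X = (∏ c_{X_i}) · kernel F m X`. [folklore] -/
theorem kernel_map_diagScale (c : Γ → R) (F : GrassmannAlgebra R Γ) (m : ℕ) (X : Fin m → Γ) :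
    kernel R (ExteriorAlgebra.map (diagScale R c) F) m X = (∏ i, c (X i)) * kernel R F m X := by
  rw [kernel_def, kernel_def, iterDeriv_map_diagScale, map_smul, constPart_map, smul_eq_mul]
  ring

/-- **Selection rule**: the kernels of a gauge-invariant `F` vanish at every label tuple whose total
gauge weight `∏ c_{X_i}` differs from `1` by a unit. [folklore] -/
theorem kernel_eq_zero_of_map_diagScale_eq {c : Γ → R} {F : GrassmannAlgebra R Γ}
    (hF : ExteriorAlgebra.map (diagScale R c) F = F) {m : ℕ} {X : Fin m → Γ}
    (hX : IsUnit (∏ i, c (X i) - 1)) : kernel R F m X = 0 := by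
  have h := kernel_map_diagScale R c F m X
  rw [hF] at h
  have h2 : (∏ i, c (X i) - 1) * kernel R F m X = 0 := by rw [sub_mul, one_mul, ← h, sub_self]
  exact (hX.mul_right_eq_zero).1 h2

variable [Fintype Γ]

/-- The Laplacian versus the diagonal scaling: `Δ_C ((c)_* a) = (c)_* (Δ_{c C c} a)`. [folklore] -/
theorem grassmannLaplacian_map_diagScale (C : Matrix Γ Γ R) (c : Γ → R) (a : GrassmannAlgebra R Γ) :
    grassmannLaplacian R C (ExteriorAlgebra.map (diagScale R c) a) =
      ExteriorAlgebra.map (diagScale R c)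
        (grassmannLaplacian R (Matrix.of fun X Y => c X * c Y * C X Y) a) := by
  rw [grassmannLaplacian_apply, grassmannLaplacian_apply, map_smul, map_sum]
  congr 1
  refine Finset.sum_congr rfl fun X _ => ?_
  rw [map_sum]
  refine Finset.sum_congr rfl fun Y _ => ?_
  rw [grassmannDeriv_map_diagScale, map_smul, grassmannDeriv_map_diagScale, map_smul, Matrix.of_apply,
    smul_smul, smul_smul]
  congr 1
  ring

/-- **Gauge covariance of the Laplacian**: if the scaling preserves the covariance
(`c_X c_Y C(X,Y) = C(X,Y)`), then `Δ_C` commutes with `(c)_*`. [folklore] -/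
theorem grassmannLaplacian_map_diagScale_of_inv {C : Matrix Γ Γ R} {c : Γ → R}
    (hC : ∀ X Y, c X * c Y * C X Y = C X Y) (a : GrassmannAlgebra R Γ) :
    grassmannLaplacian R C (ExteriorAlgebra.map (diagScale R c) a) =
      ExteriorAlgebra.map (diagScale R c) (grassmannLaplacian R C a) := by
  have h : (Matrix.of fun X Y => c X * c Y * C X Y) = C := by
    ext X Y
    rw [Matrix.of_apply, hC]
  rw [grassmannLaplacian_map_diagScale, h]

/-- **Gauge invariance of the effective action**: if the diagonal scaling `(c)_*` preserves the
covariance and the (nilpotent) interaction, it fixes `effAction C V`. [folklore] -/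
theorem map_diagScale_effAction {C : Matrix Γ Γ R} {c : Γ → R}
    (hC : ∀ X Y, c X * c Y * C X Y = C X Y) {V : GrassmannAlgebra R Γ} (hV : IsNilpotent V)
    (hinv : ExteriorAlgebra.map (diagScale R c) V = V) :
    ExteriorAlgebra.map (diagScale R c) (effAction R C V) = effAction R C V :=
  map_effAction_eq_self_of_comm R (grassmannLaplacian_map_diagScale_of_inv R hC) hV hinv

end Diag

/-! ## §7 A4: Relabellings (permutations of the labels) -/

section Relabel

variable (R : Type*) [CommRing R] {Γ : Type*}

/-- The **relabelling substitution** of a permutation `σ` of the labels: `(σ · v)_X = v_{σ⁻¹ X}`, so that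
`σ_* ψ(Y) = ψ(σ Y)`. [folklore] -/
def relabel (σ : Equiv.Perm Γ) : (Γ → R) →ₗ[R] (Γ → R) :=
  LinearMap.funLeft R R σ.symm

/-- `(σ · v)_X = v_{σ⁻¹ X}`. [folklore] -/
theorem relabel_apply (σ : Equiv.Perm Γ) (v : Γ → R) (X : Γ) : relabel R σ v X = v (σ.symm X) := rfl

/-- The coordinate form pulls back to a coordinate form: `e_X^* ∘ σ = e_{σ⁻¹ X}^*`. [folklore] -/
theorem proj_comp_relabel (σ : Equiv.Perm Γ) (X : Γ) :
    (LinearMap.proj X : (Γ → R) →ₗ[R] R).comp (relabel R σ) = LinearMap.proj (σ.symm X) :=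
  LinearMap.ext fun _ => rfl

/-- The relabelling on a basis vector. [folklore] -/
theorem relabel_single [DecidableEq Γ] (σ : Equiv.Perm Γ) (Y : Γ) :
    relabel R σ (Pi.single Y 1) = (Pi.single (σ Y) 1 : Γ → R) := by
  ext X
  rw [relabel_apply, Pi.single_apply, Pi.single_apply]
  by_cases h : X = σ Y
  · rw [if_pos h, if_pos ((Equiv.symm_apply_eq σ).2 h)]
  · rw [if_neg h, if_neg (fun h' => h ((Equiv.symm_apply_eq σ).1 h'))]

/-- `σ_* ψ(Y) = ψ(σ Y)`. [folklore] -/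
theorem map_relabel_gen [DecidableEq Γ] (σ : Equiv.Perm Γ) (Y : Γ) :
    ExteriorAlgebra.map (relabel R σ) (gen R Y) = gen R (σ Y) := by
  rw [gen, ExteriorAlgebra.map_apply_ι, relabel_single, gen]

/-- `∂_X (σ_* a) = σ_* (∂_{σ⁻¹ X} a)`. [folklore] -/
theorem grassmannDeriv_map_relabel (σ : Equiv.Perm Γ) (X : Γ) (a : GrassmannAlgebra R Γ) :
    grassmannDeriv R X (ExteriorAlgebra.map (relabel R σ) a) =
      ExteriorAlgebra.map (relabel R σ) (grassmannDeriv R (σ.symm X) a) := by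
  rw [grassmannDeriv_map, proj_comp_relabel]
  rfl

variable [Algebra ℚ R]

omit [Algebra ℚ R] in
/-- Iterated derivatives versus relabelling: `∂_X (σ_* a) = σ_* (∂_{σ⁻¹ ∘ X} a)`. [folklore] -/
theorem iterDeriv_map_relabel (σ : Equiv.Perm Γ) {m : ℕ} (X : Fin m → Γ) (a : GrassmannAlgebra R Γ) :
    iterDeriv R X (ExteriorAlgebra.map (relabel R σ) a) =
      ExteriorAlgebra.map (relabel R σ) (iterDeriv R (fun i => σ.symm (X i)) a) := by
  induction m with
  | zero => simp [iterDeriv]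
  | succ m ih =>
    have hsplit : ∀ (Y : Fin (m + 1) → Γ) (b : GrassmannAlgebra R Γ), iterDeriv R Y b =
        grassmannDeriv R (Y (Fin.last m)) (iterDeriv R (fun i => Y i.castSucc) b) := fun Y b => by
      simp only [iterDeriv, List.ofFn_succ', List.concat_eq_append, List.reverse_append,
        List.reverse_singleton, List.singleton_append, List.prod_cons, Module.End.mul_apply]
    rw [hsplit, ih, grassmannDeriv_map_relabel, hsplit]

/-- **Kernels relabel**: `kernel (σ_* F) m X = kernel F m (σ⁻¹ ∘ X)`. [folklore] -/
theorem kernel_map_relabel (σ : Equiv.Perm Γ) (F : GrassmannAlgebra R Γ) (m : ℕ) (X : Fin m → Γ) :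
    kernel R (ExteriorAlgebra.map (relabel R σ) F) m X = kernel R F m (fun i => σ.symm (X i)) := by
  rw [kernel_def, kernel_def, iterDeriv_map_relabel, constPart_map]

/-- **Covariance of the kernels**: for a `σ`-invariant `F`, `kernel F m (σ ∘ X) = kernel F m X`. [folklore] -/
theorem kernel_comp_perm_of_map_relabel_eq {σ : Equiv.Perm Γ} {F : GrassmannAlgebra R Γ}
    (hF : ExteriorAlgebra.map (relabel R σ) F = F) (m : ℕ) (X : Fin m → Γ) :
    kernel R F m (fun i => σ (X i)) = kernel R F m X := by
  have h := kernel_map_relabel R σ F m (fun i => σ (X i))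
  rw [hF] at h
  rw [h]
  simp only [Equiv.symm_apply_apply]

variable [Fintype Γ]

/-- The Laplacian versus relabelling: `Δ_C (σ_* a) = σ_* (Δ_{C ∘ (σ × σ)} a)`. [folklore] -/
theorem grassmannLaplacian_map_relabel (C : Matrix Γ Γ R) (σ : Equiv.Perm Γ) (a : GrassmannAlgebra R Γ) :
    grassmannLaplacian R C (ExteriorAlgebra.map (relabel R σ) a) =
      ExteriorAlgebra.map (relabel R σ) (grassmannLaplacian R (Matrix.of fun U V => C (σ U) (σ V)) a) := by
  rw [grassmannLaplacian_apply, grassmannLaplacian_apply, map_smul, map_sum]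
  congr 1
  rw [← Equiv.sum_comp σ]
  refine Finset.sum_congr rfl fun U _ => ?_
  rw [map_sum, ← Equiv.sum_comp σ]
  refine Finset.sum_congr rfl fun V _ => ?_
  rw [grassmannDeriv_map_relabel, grassmannDeriv_map_relabel, map_smul, Matrix.of_apply,
    Equiv.symm_apply_apply, Equiv.symm_apply_apply]

/-- **Covariance of the Laplacian**: if the covariance is `σ`-invariant (`C (σ U) (σ V) = C U V`) then
`Δ_C` commutes with `σ_*`. [folklore] -/
theorem grassmannLaplacian_map_relabel_of_inv {C : Matrix Γ Γ R} {σ : Equiv.Perm Γ}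
    (hC : ∀ U V, C (σ U) (σ V) = C U V) (a : GrassmannAlgebra R Γ) :
    grassmannLaplacian R C (ExteriorAlgebra.map (relabel R σ) a) =
      ExteriorAlgebra.map (relabel R σ) (grassmannLaplacian R C a) := by
  have h : (Matrix.of fun U V => C (σ U) (σ V)) = C := by
    ext U V
    rw [Matrix.of_apply, hC]
  rw [grassmannLaplacian_map_relabel, h]

/-- **Invariance of the effective action under a symmetry of covariance and interaction**:
`σ_* (effAction C V) = effAction C V`. [folklore] -/
theorem map_relabel_effAction {C : Matrix Γ Γ R} {σ : Equiv.Perm Γ}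
    (hC : ∀ U V, C (σ U) (σ V) = C U V) {V : GrassmannAlgebra R Γ} (hV : IsNilpotent V)
    (hinv : ExteriorAlgebra.map (relabel R σ) V = V) :
    ExteriorAlgebra.map (relabel R σ) (effAction R C V) = effAction R C V :=
  map_effAction_eq_self_of_comm R (grassmannLaplacian_map_relabel_of_inv R hC) hV hinv

end Relabel


/-! ## §8 (cycle 2) B: Support of the zero-seed CT covariance; single-mode gauge scalings -/

section Support

variable {L M : ℕ}

/-- The Nambu index of `toNambu X` is the spin of `X`. [folklore] -/
theorem toNambu_fst_snd (X : HubbardFieldIdx L M) : (toNambu X).1.2 = X.1.2 := by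
  unfold toNambu
  split_ifs with h
  · exact h.symm ▸ rfl
  · simp only
    -- X.1.2 ≠ 0 in Fin 2, so it is 1
    have : X.1.2 = 1 := by
      rcases Fin.eq_zero_or_eq_succ (n := 1) X.1.2 with h0 | ⟨j, hj⟩
      · exact (h h0).elim
      · rw [hj, Fin.eq_zero j]; rfl
    exact this.symm

/-- Two labels with the same Nambu momentum–index have the same mode `(k, σ)`. [folklore] -/
theorem fst_eq_of_toNambu_fst_eq {X Y : HubbardFieldIdx L M} (h : (toNambu X).1 = (toNambu Y).1) : X.1 = Y.1 := by
  have hσ : X.1.2 = Y.1.2 := by rw [← toNambu_fst_snd X, ← toNambu_fst_snd Y, h]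
  unfold toNambu at h
  by_cases hX : X.1.2 = 0
  · have hY : Y.1.2 = 0 := hσ ▸ hX
    rw [if_pos hX, if_pos hY] at h
    exact h
  · have hY : ¬ Y.1.2 = 0 := fun hY => hX (hσ.trans hY)
    rw [if_neg hX, if_neg hY] at h
    simp only [Prod.mk.injEq, and_true] at h
    have hk : X.1.1 = Y.1.1 := by rw [← FreqMomentum.neg_neg X.1.1, h, FreqMomentum.neg_neg]
    exact Prod.ext hk hσ

/-- Within one mode, `toNambu` distinguishes the charge index. [folklore] -/
theorem toNambu_snd_ne_of {X Y : HubbardFieldIdx L M} (h1 : X.1 = Y.1) (h2 : (toNambu X).2 ≠ (toNambu Y).2) :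
    X.2 ≠ Y.2 := by
  intro h
  apply h2
  unfold toNambu
  by_cases hX : X.1.2 = 0
  · have hY : Y.1.2 = 0 := h1 ▸ hX
    rw [if_pos hX, if_pos hY, h]
  · have hY : ¬ Y.1.2 = 0 := fun hY => hX (h1.symm ▸ hY)
    rw [if_neg hX, if_neg hY]
    simp only [h]

/-- **At zero seed the CT Nambu table is diagonal in the Nambu index**: it vanishes unless the two
labels are `(Ψ⁻, Ψ⁺)` at the same Nambu momentum AND index. [folklore] -/
theorem nambuTwoPointCT_zero_seed_eq_zero (β μ : ℝ) (K : TrigPolyC4v)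
    {X Y : (FreqMomentum L M × Fin 2) × Fin 2} (h : ¬ (X.2 = 1 ∧ Y.2 = 0 ∧ X.1 = Y.1)) :
    nambuTwoPointCT L M β μ 0 K X Y = 0 := by
  unfold nambuTwoPointCT
  split_ifs with hc
  · obtain ⟨h1, h2, h3⟩ := hc
    have hne : X.1.2 ≠ Y.1.2 := fun hidx => h ⟨h1, h2, Prod.ext h3 hidx⟩
    have hoff : nambuPropagatorCT L M β μ 0 K X.1.1 X.1.2 Y.1.2 = 0 := by
      have key : ∀ a b : Fin 2, a ≠ b → nambuPropagatorCT L M β μ 0 K X.1.1 a b = 0 := by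
        intro a b hab
        fin_cases a <;> fin_cases b
        · exact (hab rfl).elim
        · simp [nambuPropagatorCT]
        · simp [nambuPropagatorCT]
        · exact (hab rfl).elim
      exact key _ _ hne
    rw [hoff, mul_zero]
  · rfl

/-- **Support of the CT two-point table at zero seed**: `⟨ψ_X ψ_Y⟩₀^K ≠ 0` only for the two labels
`ψ^±` of ONE mode `(k, σ)`. [folklore] -/
theorem hubbardTwoPointCT_zero_seed_eq_zero (β μ : ℝ) (K : TrigPolyC4v) {X Y : HubbardFieldIdx L M}
    (h : ¬ (X.1 = Y.1 ∧ X.2 ≠ Y.2)) : hubbardTwoPointCT L M β μ 0 K X Y = 0 := by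
  have hXY : nambuTwoPointCT L M β μ 0 K (toNambu X) (toNambu Y) = 0 := by
    refine nambuTwoPointCT_zero_seed_eq_zero β μ K fun ⟨h1, h2, h3⟩ => h ?_
    have hm : X.1 = Y.1 := fst_eq_of_toNambu_fst_eq h3
    exact ⟨hm, toNambu_snd_ne_of hm (by rw [h1, h2]; exact one_ne_zero)⟩
  have hYX : nambuTwoPointCT L M β μ 0 K (toNambu Y) (toNambu X) = 0 := by
    refine nambuTwoPointCT_zero_seed_eq_zero β μ K fun ⟨h1, h2, h3⟩ => h ?_
    have hm : Y.1 = X.1 := fst_eq_of_toNambu_fst_eq h3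
    exact ⟨hm.symm, (toNambu_snd_ne_of hm (by rw [h1, h2]; exact one_ne_zero)).symm⟩
  rw [hubbardTwoPointCT, hXY, hYX, sub_zero]

/-- Hence the CT covariance above any scale, at zero seed, is supported on pairs of labels of one
mode. [folklore] -/
theorem hubbardCovAboveCT_zero_seed_eq_zero (β μ : ℝ) (K : TrigPolyC4v) (Λ : ℝ) {X Y : HubbardFieldIdx L M}
    (h : ¬ (X.1 = Y.1 ∧ X.2 ≠ Y.2)) : hubbardCovAboveCT L M β μ 0 K Λ X Y = 0 := by
  rw [hubbardCovAboveCT, Matrix.of_apply, hubbardCovarianceCT, Matrix.of_apply,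
    hubbardTwoPointCT_zero_seed_eq_zero β μ K h, neg_zero, mul_zero]

end Support

section Gauge

variable {L M : ℕ}

/-- The **single-mode gauge scaling** `ψ⁺_{m₀} ↦ t ψ⁺_{m₀}`, `ψ⁻_{m₀} ↦ t⁻¹ ψ⁻_{m₀}`, all other
generators fixed. [folklore] -/
def modeGauge (m₀ : FreqMomentum L M × Fin 2) (t : ℂ) (X : HubbardFieldIdx L M) : ℂ :=
  if X.1 = m₀ then (if X.2 = 0 then t else t⁻¹) else 1

/-- On the two charge labels of one mode the gauge weights multiply to `1`. [folklore] -/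
theorem modeGauge_mul_of_mode_eq {m₀ : FreqMomentum L M × Fin 2} {t : ℂ} (ht : t ≠ 0)
    {X Y : HubbardFieldIdx L M} (h1 : X.1 = Y.1) (h2 : X.2 ≠ Y.2) :
    modeGauge m₀ t X * modeGauge m₀ t Y = 1 := by
  unfold modeGauge
  rw [← h1]
  by_cases hm : X.1 = m₀
  · rw [if_pos hm, if_pos hm]
    have hcases : (X.2 = 0 ∧ Y.2 = 1) ∨ (X.2 = 1 ∧ Y.2 = 0) := by
      revert h2
      rcases Fin.exists_fin_two.1 ⟨X.2, rfl⟩ with hX | hX <;>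
        rcases Fin.exists_fin_two.1 ⟨Y.2, rfl⟩ with hY | hY <;> simp [hX, hY]
    rcases hcases with ⟨hX, hY⟩ | ⟨hX, hY⟩
    · rw [if_pos hX, if_neg (by rw [hY]; exact one_ne_zero), mul_inv_cancel₀ ht]
    · rw [if_neg (by rw [hX]; exact one_ne_zero), if_pos hY, inv_mul_cancel₀ ht]
  · rw [if_neg hm, if_neg hm, one_mul]

/-- **The single-mode gauge scaling preserves the zero-seed CT covariance** (in every frame, at every
scale). [folklore] -/
theorem modeGauge_preserves_hubbardCovAboveCT (m₀ : FreqMomentum L M × Fin 2) {t : ℂ} (ht : t ≠ 0)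
    (β μ : ℝ) (K : TrigPolyC4v) (Λ : ℝ) (X Y : HubbardFieldIdx L M) :
    modeGauge m₀ t X * modeGauge m₀ t Y * hubbardCovAboveCT L M β μ 0 K Λ X Y =
      hubbardCovAboveCT L M β μ 0 K Λ X Y := by
  by_cases h : X.1 = Y.1 ∧ X.2 ≠ Y.2
  · rw [modeGauge_mul_of_mode_eq ht h.1 h.2, one_mul]
  · rw [hubbardCovAboveCT_zero_seed_eq_zero β μ K Λ h, mul_zero]

end Gauge


/-! ## §8 C: The free effective action of a frame is gauge invariant; its Cooper amplitude is diagonal -/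

section FreeAction

variable {L M : ℕ} [NeZero L]

omit [NeZero L] in
/-- The single-mode gauge scaling fixes every `ψ⁺_{kσ} ψ⁻_{kσ}`. [folklore] -/
theorem map_modeGauge_psiPlus_mul_psiMinus (m₀ : FreqMomentum L M × Fin 2) {t : ℂ} (ht : t ≠ 0)
    (k : FreqMomentum L M) (σ : Fin 2) :
    ExteriorAlgebra.map (diagScale ℂ (modeGauge m₀ t)) (psiPlus k σ * psiMinus k σ) = psiPlus k σ * psiMinus k σ := by
  rw [map_mul, psiPlus, psiMinus, map_diagScale_gen, map_diagScale_gen, smul_mul_smul_comm,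
    modeGauge_mul_of_mode_eq ht (X := ((k, σ), 0)) (Y := ((k, σ), 1)) rfl (by exact zero_ne_one), one_smul]

/-- The single-mode gauge scaling fixes the quadratic counterterm `𝒩_K` of every frame. [folklore] -/
theorem map_modeGauge_counterQuadratic (m₀ : FreqMomentum L M × Fin 2) {t : ℂ} (ht : t ≠ 0) (β : ℝ)
    (K : TrigPolyC4v) :
    ExteriorAlgebra.map (diagScale ℂ (modeGauge m₀ t)) (counterQuadratic L M β K) = counterQuadratic L M β K := by
  simp only [counterQuadratic, map_sum, map_smul, map_modeGauge_psiPlus_mul_psiMinus m₀ ht]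

/-- At `U = 0` the interaction slot of the frame `K` is the counterterm alone: `V_K = 𝒩_K`. [folklore] -/
theorem hubbardInteractionCT_free (β : ℝ) (K : TrigPolyC4v) :
    hubbardInteractionCT L M β 0 K = counterQuadratic L M β K := by
  have h : hubbardInteraction L M β 0 = 0 := by simp [hubbardInteraction]
  rw [hubbardInteractionCT, h, zero_add]

/-- **Gauge invariance of the free effective action in every frame**: at `U = 0` the effective action
`𝒢^K_Λ` at zero seed is fixed by EVERY single-mode gauge scaling `ψ^±_{m₀} ↦ t^{±1} ψ^±_{m₀}` — the
`U(1)^{modes}` symmetry of a quadratic, mode-diagonal theory. [folklore] -/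
theorem map_modeGauge_hubbardEffectiveActionCT_free (m₀ : FreqMomentum L M × Fin 2) {t : ℂ} (ht : t ≠ 0)
    (β μ : ℝ) (K : TrigPolyC4v) (Λ : ℝ) :
    ExteriorAlgebra.map (diagScale ℂ (modeGauge m₀ t)) (hubbardEffectiveActionCT L M β 0 μ 0 K Λ) =
      hubbardEffectiveActionCT L M β 0 μ 0 K Λ := by
  rw [hubbardEffectiveActionCT]
  refine map_diagScale_effAction ℂ (modeGauge_preserves_hubbardCovAboveCT m₀ ht β μ K Λ)
    (isNilpotent_hubbardInteractionCT L M β 0 K) ?_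
  rw [hubbardInteractionCT_free, map_modeGauge_counterQuadratic m₀ ht]

variable [NeZero M]

/-- **The free Cooper amplitude is diagonal in every frame**: at `U = 0`, for `k⃗ ≠ k⃗'`,
`𝒞(k⃗, k⃗') = 0` — the Cooper label tuple carries gauge weight `t⁻¹ ≠ 1` for the mode `((ω₀, k⃗), ↑)`.
[folklore] -/
theorem cooperAmplitude_free_eq_zero_of_ne (β μ : ℝ) (K : TrigPolyC4v) (Λ : ℝ) {k k' : TorusSite 2 L}
    (hkk' : k ≠ k') :
    cooperAmplitude L M β (hubbardEffectiveActionCT L M β 0 μ 0 K Λ) k k' = 0 := by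
  have hinv := map_modeGauge_hubbardEffectiveActionCT_free (L := L) (M := M) ((omega0 M, k), 0)
    (t := 2) two_ne_zero β μ K Λ
  have hker : kernel ℂ (hubbardEffectiveActionCT L M β 0 μ 0 K Λ) 4
      ![(((omega0 M, k'), 0), 0), ((FreqMomentum.neg (omega0 M, k'), 1), 0),
        ((FreqMomentum.neg (omega0 M, k), 1), 1), (((omega0 M, k), 0), 1)] = 0 := by
    refine kernel_eq_zero_of_map_diagScale_eq ℂ hinv ?_
    rw [isUnit_iff_ne_zero, Fin.prod_univ_four]
    have h0 : modeGauge ((omega0 M, k), 0) (2 : ℂ) (((omega0 M, k'), 0), 0) = 1 := by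
      unfold modeGauge
      rw [if_neg]
      simp only [Prod.mk.injEq, and_true]
      exact fun h => hkk' h.2.symm
    have h1 : modeGauge ((omega0 M, k), 0) (2 : ℂ) ((FreqMomentum.neg (omega0 M, k'), 1), 0) = 1 := by
      unfold modeGauge
      rw [if_neg]
      simp only [Prod.mk.injEq, one_ne_zero, and_false, not_false_eq_true]
    have h2 : modeGauge ((omega0 M, k), 0) (2 : ℂ) ((FreqMomentum.neg (omega0 M, k), 1), 1) = 1 := by
      unfold modeGauge
      rw [if_neg]
      simp only [Prod.mk.injEq, one_ne_zero, and_false, not_false_eq_true]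
    have h3 : modeGauge ((omega0 M, k), 0) (2 : ℂ) (((omega0 M, k), 0), 1) = 2⁻¹ := by
      unfold modeGauge
      rw [if_pos rfl, if_neg (by exact one_ne_zero)]
    simp only [Matrix.cons_val_zero, Matrix.cons_val_one, Matrix.cons_val_two, Matrix.cons_val_three,
      Matrix.head_cons, Matrix.tail_cons, h0, h1, h2, h3]
    norm_num
  rw [cooperAmplitude, vertexFn, hker, mul_zero]

end FreeAction

/-! ## §8 C′ (cycle 2) Parity: the countertermed effective action is even, so its odd vertex functions vanish -/

section Parity

variable {L M : ℕ} [NeZero L]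

/-- The Hubbard vertex is even: fixed by the parity scaling `ψ ↦ -ψ`. [folklore] -/
theorem map_parity_hubbardInteraction (β U : ℝ) :
    ExteriorAlgebra.map (diagScale ℂ (fun _ : HubbardFieldIdx L M => (-1 : ℂ))) (hubbardInteraction L M β U) =
      hubbardInteraction L M β U := by
  unfold hubbardInteraction
  simp only [map_smul, map_sum, apply_ite (ExteriorAlgebra.map (diagScale ℂ fun _ : HubbardFieldIdx L M => (-1 : ℂ))),
    map_mul, map_zero, psiPlus, psiMinus, map_diagScale_gen, neg_one_smul, neg_mul, mul_neg, neg_neg]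

/-- The counterterm of every frame is even. [folklore] -/
theorem map_parity_counterQuadratic (β : ℝ) (K : TrigPolyC4v) :
    ExteriorAlgebra.map (diagScale ℂ (fun _ : HubbardFieldIdx L M => (-1 : ℂ))) (counterQuadratic L M β K) =
      counterQuadratic L M β K := by
  unfold counterQuadratic
  simp only [map_sum, map_smul, map_mul, psiPlus, psiMinus, map_diagScale_gen, neg_one_smul, neg_mul, mul_neg,
    neg_neg]

/-- **The countertermed effective action is even** (every `U`, `μ`, seed `h`, frame, scale): it is fixed by the
parity scaling `ψ(X) ↦ -ψ(X)`, which preserves every covariance. [folklore] -/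
theorem map_parity_hubbardEffectiveActionCT (β U μ h : ℝ) (K : TrigPolyC4v) (Λ : ℝ) :
    ExteriorAlgebra.map (diagScale ℂ (fun _ : HubbardFieldIdx L M => (-1 : ℂ))) (hubbardEffectiveActionCT L M β U μ h K Λ) =
      hubbardEffectiveActionCT L M β U μ h K Λ := by
  rw [hubbardEffectiveActionCT]
  refine map_diagScale_effAction ℂ (fun X Y => by ring) (isNilpotent_hubbardInteractionCT L M β U K) ?_
  rw [hubbardInteractionCT, map_add, map_parity_hubbardInteraction, map_parity_counterQuadratic]

/-- **Odd vertex functions of the countertermed effective action vanish** (so clause (i′b) at `m_max = 10`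
charges exactly `‖𝒱₆‖, ‖𝒱₈‖, ‖𝒱₁₀‖`). [folklore] -/
theorem vertexFn_hubbardCT_eq_zero_of_odd (β U μ h : ℝ) (K : TrigPolyC4v) (Λ : ℝ) {m : ℕ} (hm : Odd m)
    (X : Fin m → HubbardFieldIdx L M) :
    vertexFn L M β (hubbardEffectiveActionCT L M β U μ h K Λ) m X = 0 := by
  have hker : kernel ℂ (hubbardEffectiveActionCT L M β U μ h K Λ) m X = 0 := by
    refine kernel_eq_zero_of_map_diagScale_eq ℂ (map_parity_hubbardEffectiveActionCT β U μ h K Λ) ?_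
    rw [Finset.prod_const, Finset.card_univ, Fintype.card_fin, hm.neg_one_pow, isUnit_iff_ne_zero]
    norm_num
  rw [vertexFn, hker, mul_zero]

/-- The sup norms of the odd vertex functions vanish. [folklore] -/
theorem vertexSupNorm_hubbardCT_eq_zero_of_odd (β U μ h : ℝ) (K : TrigPolyC4v) (Λ : ℝ) {m : ℕ} (hm : Odd m) :
    vertexSupNorm L M β (hubbardEffectiveActionCT L M β U μ h K Λ) m = 0 := by
  simp only [vertexSupNorm, vertexFn_hubbardCT_eq_zero_of_odd β U μ h K Λ hm, norm_zero, Real.iSup_const_zero]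

end Parity

/-! ## §8 D: Diagonal Cooper amplitudes certify nothing; no certificate at `U = 0` in any frame -/

section Diagonal

variable {L M : ℕ} [NeZero L] [NeZero M]

/-- For a matrix with vanishing off-diagonal entries, `⟨v, A v⟩ = Σ_k A_kk |v_k|²`. [folklore] -/
theorem star_dotProduct_mulVec_of_offDiag_eq_zero {A : Matrix (TorusSite 2 L) (TorusSite 2 L) ℂ}
    (hA : ∀ k k', k ≠ k' → A k k' = 0) (v : TorusSite 2 L → ℂ) :
    star v ⬝ᵥ (A *ᵥ v) = ∑ k, A k k * ((‖v k‖ ^ 2 : ℝ) : ℂ) := by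
  unfold dotProduct
  refine Finset.sum_congr rfl fun k _ => ?_
  have hk : (A *ᵥ v) k = A k k * v k := by
    rw [Matrix.mulVec, dotProduct, Finset.sum_eq_single k (fun k' _ hk' => by rw [hA k k' (Ne.symm hk'), zero_mul])
      (fun h => (h (Finset.mem_univ k)).elim)]
  rw [hk, Pi.star_apply, Complex.star_def, Complex.ofReal_pow, ← Complex.conj_mul']
  ring

/-- **A shell-diagonal Cooper amplitude certifies nothing.**  If `𝒞(k⃗, k⃗') = 0` for all `k⃗ ≠ k⃗'` on the
shell, then under clause (ii′)-Cooper the `B₁g` bottom `f` and its modulus `|f|` (a unit vector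
ORTHOGONAL to `f`, by rotation-oddness) have the same Rayleigh quotient, so the margin-`2` condition
forces `λ_d ≤ 0`: no interval with `a > 0` certifies `G` — whatever the data, band, scale, normaliser.
(No symmetry of `G` is needed.) [folklore] -/
theorem not_symmetricCertifiedAtT_of_cooperAmplitude_offDiag_eq_zero {π : SymmetricRegimeDataT}
    {Θ : SymmetricTolerance} {a b : ℚ} (ha : 0 < a) {Λ β : ℝ} {e : TorusSite 2 L → ℝ}
    {G : HubbardGrassmann L M} {Z : ℂ}
    (h0 : ∀ k ∈ momentumShell L e Λ, ∀ k' ∈ momentumShell L e Λ, k ≠ k' → cooperAmplitude L M β G k k' = 0) :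
    ¬ SymmetricCertifiedAtT π Θ a b Λ L M β e G Z := by
  intro h
  obtain ⟨f, hf1, hB, hbot, hmargin⟩ := h.cooperDominance
  have hwin := h.window.1
  set A := cooperMatrix L M β e Λ G with hAdef
  -- the Cooper matrix has no off-diagonal entries
  have hA : ∀ k k', k ≠ k' → A k k' = 0 := fun k k' hkk' => by
    rw [hAdef, cooperMatrix, Matrix.of_apply]
    split_ifs with hS
    · rw [h0 k hS.1 k' hS.2 hkk', mul_zero, zero_mul]
    · rfl
  -- the modulus of the `B₁g` bottom
  let g : TorusSite 2 L → ℂ := fun k => ((‖f k‖ : ℝ) : ℂ)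
  have hg1 : star g ⬝ᵥ g = 1 := by
    have h1 := sum_norm_sq_eq_one_of_unit hf1
    simp only [dotProduct, Pi.star_apply, g, Complex.star_def, Complex.conj_ofReal, ← sq]
    exact_mod_cast h1
  have hfg : star f ⬝ᵥ g = 0 := by
    have hodd : ∀ k, (fun k => conj (f k) * ((‖f k‖ : ℝ) : ℂ)) (rotSite k) =
        -(fun k => conj (f k) * ((‖f k‖ : ℝ) : ℂ)) k := fun k => by
      simp only [rot_odd_of_isB1g hB k, map_neg, norm_neg]
      ring
    have hsum := sum_sqrt_mul_eq_zero_of_rot_odd (Finset.univ : Finset (TorusSite 2 L)) (fun _ => (1 : ℝ))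
      (fun k => conj (f k) * ((‖f k‖ : ℝ) : ℂ)) (fun k => by simp) (fun _ => rfl) hodd
    simp only [Real.sqrt_one, Complex.ofReal_one, one_mul] at hsum
    simpa only [dotProduct, Pi.star_apply, Complex.star_def, g] using hsum
  -- `f` and `|f|` have the same Rayleigh quotient
  have hre : reRayleigh A g = reRayleigh A f := by
    simp only [reRayleigh, star_dotProduct_mulVec_of_offDiag_eq_zero hA, g, Complex.norm_real, norm_norm]
  have hm := hmargin g hg1 hfg
  rw [hre, hbot] at hm
  have hpos : (0 : ℝ) < (-A).supRayleigh := by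
    have : (0 : ℝ) < a := by exact_mod_cast ha
    exact lt_of_lt_of_le this hwin
  have h2 : (symmetricCooperMargin : ℝ) = 2 := by norm_num [symmetricCooperMargin]
  rw [h2] at hm
  linarith

/-- **No certificate at `U = 0`, in ANY frame**: for every chemical potential, data, tolerance, frame
`K`, scale and threshold, `symmetricRegimeCertificateT 0 μ π Θ K Λ L₀` is FALSE — the free effective
action of the frame `K` has a diagonal Cooper amplitude (`cooperAmplitude_free_eq_zero_of_ne`), which
certifies nothing.  (The tree's junk test `not_symmetricRegimeCertificateT_free` is the bare frame
`K = 0`; this is the general frame, left open in `SymmetricRegimeCertificate.lean`, "NOT claimed".)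
So the hypothesis `U ∈ [2, 3]` of the crux is load-bearing beyond `U ≠ 0` bookkeeping: a proof must
use the quartic vertex. [folklore] -/
theorem not_symmetricRegimeCertificateT_free_frame (μ : ℝ) (π : SymmetricRegimeDataT) (Θ : SymmetricTolerance)
    (K : TrigPolyC4v) (Λ : ℝ) (L₀ : ℕ) : ¬ symmetricRegimeCertificateT 0 μ π Θ K Λ L₀ := by
  intro h
  obtain ⟨a, b, ha, -, -, hblock⟩ := SymmetricRegimeHoldsT.exists_window h
  haveI : NeZero (L₀ + 1) := ⟨Nat.succ_ne_zero _⟩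
  obtain ⟨β₀, hβ₀⟩ := hblock (L₀ + 1) (Nat.le_succ _)
  obtain ⟨M₀, hM₀⟩ := hβ₀ β₀ le_rfl
  haveI : NeZero (M₀ + 1) := ⟨Nat.succ_ne_zero _⟩
  have hc : SymmetricCertifiedAtT π Θ a b Λ (L₀ + 1) (M₀ + 1) β₀ (nambuXiCT (L₀ + 1) μ K)
      (hubbardEffectiveActionCT (L₀ + 1) (M₀ + 1) β₀ 0 μ 0 K Λ)
      (hubbardEffPartitionFnCT (L₀ + 1) (M₀ + 1) β₀ 0 μ 0 K Λ) := hM₀ (M₀ + 1) (Nat.le_succ _)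
  exact not_symmetricCertifiedAtT_of_cooperAmplitude_offDiag_eq_zero ha
    (fun k _ k' _ hkk' => cooperAmplitude_free_eq_zero_of_ne β₀ μ K Λ hkk') hc

/-- **Crux-level form (`_false_without_` the coupling interval)**: the certificate half of
`CapRgSymmetricCertificatePinned` — `∀ Θ, ∃ K Λ L₀, symmetricRegimeCertificateT U μ π₀ Θ K Λ L₀` — is
FALSE at `U = 0` for every `μ`; the natural strengthening of the crux to the coupling range `[0, 3]`
pinned at its left end fails, and any proof of the crux must exploit `U > 0` through the quartic
vertex itself (not only through `λ_d ≠ 0` in the bare frame). [folklore] -/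
theorem capRg_certificateHalf_false_at_free (μ : ℝ) :
    ¬ ∀ Θ : SymmetricTolerance, ∃ (K : TrigPolyC4v) (Λ : ℝ) (L₀ : ℕ),
      symmetricRegimeCertificateT 0 μ capRgCornerDataT Θ K Λ L₀ := by
  intro h
  obtain ⟨K, Λ, L₀, hK⟩ := h ⟨1, one_pos, 1, one_pos⟩
  exact not_symmetricRegimeCertificateT_free_frame μ capRgCornerDataT _ K Λ L₀ hK


/-- **The crux pinned at zero coupling** (`U := 0` in place of `∃ U ∈ [2,3]`; the `_false_without_` form of the
coupling hypothesis for an existential crux): density clause at `U = 0` and the certificate half at `U = 0`. -/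
def CapRgSymmetricCertificatePinnedAtZeroCoupling : Prop :=
  ∃ δ ∈ Set.Icc (1/5:ℝ) (7/20), ∃ μ : ℝ, Filter.Tendsto (fun L : ℕ =>
    ((hubbardTorusWith 2 (L + 1) 1 0 μ).groundStateFunctional totalNumber).re / ((L + 1 : ℕ) : ℝ) ^ 2)
    Filter.atTop (nhds (1 - δ)) ∧
  ∀ Θ : SymmetricTolerance, ∃ (K : TrigPolyC4v) (Λ : ℝ) (L₀ : ℕ), symmetricRegimeCertificateT 0 μ capRgCornerDataT Θ K Λ L₀

/-- **`_false_without_` the coupling**: the crux pinned at `U = 0` is FALSE (whatever the density clause does at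
`U = 0`), by `capRg_certificateHalf_false_at_free`. [folklore] -/
theorem capRgSymmetricCertificatePinned_false_at_zero_coupling : ¬ CapRgSymmetricCertificatePinnedAtZeroCoupling := by
  rintro ⟨-, -, μ, -, h⟩
  exact capRg_certificateHalf_false_at_free μ h

end Diagonal


/-! ## §9 (cycle 2) E: The rotation by `π/2` as a symmetry of the countertermed effective action -/

section Rotation

variable {L : ℕ}

/-- The rotation by `π/2` of the dual torus as a permutation. [folklore] -/
def rotSiteEquiv : Equiv.Perm (TorusSite 2 L) where
  toFun := rotSite
  invFun x := ![x 1, -x 0]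
  left_inv x := by ext i; fin_cases i <;> simp [rotSite]
  right_inv x := by ext i; fin_cases i <;> simp [rotSite]

/-- `rotSiteEquiv` is `rotSite`. [folklore] -/
@[simp] theorem rotSiteEquiv_apply (k : TorusSite 2 L) : rotSiteEquiv k = rotSite k := rfl

/-- The rotation is additive. [folklore] -/
theorem rotSite_add (a b : TorusSite 2 L) : rotSite (a + b) = rotSite a + rotSite b := by
  ext i; fin_cases i <;> simp [rotSite, add_comm]

/-- The rotation commutes with negation. [folklore] -/
theorem rotSite_neg' (a : TorusSite 2 L) : rotSite (-a) = -rotSite a := by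
  ext i; fin_cases i <;> simp [rotSite]

variable [NeZero L]

/-- `cos(m p₀(rot k⃗)) = cos(m p₁(k⃗))`. [folklore] -/
theorem cos_nat_mul_latticeMomentum_rotSite_zero (m : ℕ) (k : TorusSite 2 L) :
    Real.cos (m * latticeMomentum L (rotSite k) 0) = Real.cos (m * latticeMomentum L k 1) := by
  have h : latticeMomentum L (rotSite k) 0 = latticeMomentum L (-k) 1 := by
    simp [latticeMomentum, rotSite]
  rw [h, TrigPolyC4v.cos_nat_mul_latticeMomentum_neg]

omit [NeZero L] in
/-- `p₁(rot k⃗) = p₀(k⃗)`. [folklore] -/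
theorem latticeMomentum_rotSite_one (k : TorusSite 2 L) :
    latticeMomentum L (rotSite k) 1 = latticeMomentum L k 0 := by
  simp [latticeMomentum, rotSite]

/-- The harmonics are rotation invariant on the dual torus. [folklore] -/
theorem harmonic_latticeMomentum_rotSite (m n : ℕ) (k : TorusSite 2 L) :
    TrigPolyC4v.harmonic m n (latticeMomentum L (rotSite k)) = TrigPolyC4v.harmonic m n (latticeMomentum L k) := by
  simp only [TrigPolyC4v.harmonic, cos_nat_mul_latticeMomentum_rotSite_zero, latticeMomentum_rotSite_one]
  ring

/-- **Frames are rotation invariant on the dual torus**: `K(p(rot k⃗)) = K(p(k⃗))`. [folklore] -/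
theorem eval_latticeMomentum_rotSite (K : TrigPolyC4v) (k : TorusSite 2 L) :
    K.eval (latticeMomentum L (rotSite k)) = K.eval (latticeMomentum L k) := by
  simp only [TrigPolyC4v.eval, harmonic_latticeMomentum_rotSite]

/-- The band is rotation invariant: `ε_L(rot k⃗) = ε_L(k⃗)`. [folklore] -/
theorem torusBand_rotSite (k : TorusSite 2 L) : torusBand L (rotSite k) = torusBand L k := by
  have h0 : Real.cos (latticeMomentum L (rotSite k) 0) = Real.cos (latticeMomentum L k 1) := by
    simpa using cos_nat_mul_latticeMomentum_rotSite_zero 1 k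
  simp only [torusBand, Fin.sum_univ_two, h0, latticeMomentum_rotSite_one]
  ring

/-- **The renormalised band of every frame is rotation invariant**: `e_K(rot k⃗) = e_K(k⃗)`. [folklore] -/
theorem nambuXiCT_rotSite (μ : ℝ) (K : TrigPolyC4v) (k : TorusSite 2 L) :
    nambuXiCT L μ K (rotSite k) = nambuXiCT L μ K k := by
  rw [nambuXiCT, nambuXiCT, torusBand_rotSite, eval_latticeMomentum_rotSite]

variable {M : ℕ}

/-- The rotation on frequency–momenta. [folklore] -/
def rotFreqMomentum : Equiv.Perm (FreqMomentum L M) :=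
  Equiv.prodCongr (Equiv.refl _) rotSiteEquiv

omit [NeZero L] in
/-- `rotFreqMomentum (ω, k⃗) = (ω, rot k⃗)`. [folklore] -/
@[simp] theorem rotFreqMomentum_apply (k : FreqMomentum L M) : rotFreqMomentum k = (k.1, rotSite k.2) := rfl

omit [NeZero L] in
/-- The rotation commutes with `(ω, k⃗) ↦ (-ω, -k⃗)`. [folklore] -/
theorem rotFreqMomentum_neg (k : FreqMomentum L M) : rotFreqMomentum k.neg = (rotFreqMomentum k).neg := by
  simp only [rotFreqMomentum_apply, FreqMomentum.neg, rotSite_neg']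

/-- **The rotation on field labels** `(((ω, k⃗), σ), ±) ↦ (((ω, rot k⃗), σ), ±)`. [folklore] -/
def rotLabel : Equiv.Perm (HubbardFieldIdx L M) :=
  Equiv.prodCongr (Equiv.prodCongr rotFreqMomentum (Equiv.refl _)) (Equiv.refl _)

omit [NeZero L] in
/-- `rotLabel` in coordinates. [folklore] -/
@[simp] theorem rotLabel_apply (X : HubbardFieldIdx L M) : rotLabel X = ((rotFreqMomentum X.1.1, X.1.2), X.2) := rfl

/-- At zero seed the CT Nambu propagator is rotation invariant. [folklore] -/
theorem nambuPropagatorCT_zero_seed_rotSite (β μ : ℝ) (K : TrigPolyC4v) (k : FreqMomentum L M) :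
    nambuPropagatorCT L M β μ 0 K (rotFreqMomentum k) = nambuPropagatorCT L M β μ 0 K k := by
  simp only [nambuPropagatorCT, nambuDenCT, rotFreqMomentum_apply, nambuXiCT_rotSite, zero_mul]

omit [NeZero L] in
/-- `toNambu` commutes with the rotation. [folklore] -/
theorem toNambu_rotLabel (X : HubbardFieldIdx L M) :
    toNambu (rotLabel X) = ((rotFreqMomentum (toNambu X).1.1, (toNambu X).1.2), (toNambu X).2) := by
  unfold toNambu
  simp only [rotLabel_apply]
  split_ifs with h
  · rfl
  · simp only [rotFreqMomentum_neg]

/-- At zero seed the CT Nambu table is rotation invariant. [folklore] -/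
theorem nambuTwoPointCT_zero_seed_rot (β μ : ℝ) (K : TrigPolyC4v) (X Y : (FreqMomentum L M × Fin 2) × Fin 2) :
    nambuTwoPointCT L M β μ 0 K ((rotFreqMomentum X.1.1, X.1.2), X.2) ((rotFreqMomentum Y.1.1, Y.1.2), Y.2) =
      nambuTwoPointCT L M β μ 0 K X Y := by
  unfold nambuTwoPointCT
  simp only [EmbeddingLike.apply_eq_iff_eq, nambuPropagatorCT_zero_seed_rotSite]

/-- At zero seed the CT two-point table is rotation invariant. [folklore] -/
theorem hubbardTwoPointCT_zero_seed_rotLabel (β μ : ℝ) (K : TrigPolyC4v) (X Y : HubbardFieldIdx L M) :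
    hubbardTwoPointCT L M β μ 0 K (rotLabel X) (rotLabel Y) = hubbardTwoPointCT L M β μ 0 K X Y := by
  rw [hubbardTwoPointCT, hubbardTwoPointCT, toNambu_rotLabel, toNambu_rotLabel, nambuTwoPointCT_zero_seed_rot,
    nambuTwoPointCT_zero_seed_rot]

/-- The CT cutoff weight is rotation invariant. [folklore] -/
theorem hubbardCutoffWeightCT_rot (β μ : ℝ) (K : TrigPolyC4v) (Λ : ℝ) (k : FreqMomentum L M) :
    hubbardCutoffWeightCT L M β μ K Λ (rotFreqMomentum k) = hubbardCutoffWeightCT L M β μ K Λ k := by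
  simp only [hubbardCutoffWeightCT, rotFreqMomentum_apply, nambuXiCT_rotSite]

/-- **At zero seed the CT covariance above every scale is rotation invariant** (every frame). [folklore] -/
theorem hubbardCovAboveCT_rotLabel (β μ : ℝ) (K : TrigPolyC4v) (Λ : ℝ) (X Y : HubbardFieldIdx L M) :
    hubbardCovAboveCT L M β μ 0 K Λ (rotLabel X) (rotLabel Y) = hubbardCovAboveCT L M β μ 0 K Λ X Y := by
  rw [hubbardCovAboveCT, Matrix.of_apply, Matrix.of_apply, hubbardCovarianceCT, Matrix.of_apply, Matrix.of_apply,
    hubbardTwoPointCT_zero_seed_rotLabel]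
  simp only [momentumOf, rotLabel_apply, hubbardCutoffWeightCT_rot]

omit [NeZero L] in
/-- The rotation of the labels sends `ψ⁺_{kσ}` to `ψ⁺_{ρk,σ}`. [folklore] -/
theorem map_rotLabel_psiPlus (k : FreqMomentum L M) (σ : Fin 2) :
    ExteriorAlgebra.map (relabel ℂ (rotLabel (L := L) (M := M))) (psiPlus k σ) = psiPlus (rotFreqMomentum k) σ := by
  rw [psiPlus, map_relabel_gen, psiPlus]; rfl

omit [NeZero L] in
/-- The rotation of the labels sends `ψ⁻_{kσ}` to `ψ⁻_{ρk,σ}`. [folklore] -/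
theorem map_rotLabel_psiMinus (k : FreqMomentum L M) (σ : Fin 2) :
    ExteriorAlgebra.map (relabel ℂ (rotLabel (L := L) (M := M))) (psiMinus k σ) = psiMinus (rotFreqMomentum k) σ := by
  rw [psiMinus, map_relabel_gen, psiMinus]; rfl

/-- **The Hubbard vertex is rotation invariant** (the rotation is additive on the dual torus, so it
preserves momentum conservation). [folklore] -/
theorem map_rotLabel_hubbardInteraction (β U : ℝ) :
    ExteriorAlgebra.map (relabel ℂ (rotLabel (L := L) (M := M))) (hubbardInteraction L M β U) =
      hubbardInteraction L M β U := by
  unfold hubbardInteraction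
  rw [map_smul]
  congr 1
  simp only [map_sum]
  -- the summand after the substitution is the original summand at rotated momenta
  have hsum : ∀ k₁ k₂ k₃ k₄ : FreqMomentum L M,
      ExteriorAlgebra.map (relabel ℂ (rotLabel (L := L) (M := M)))
        (if matsubaraInt M k₁.1 + matsubaraInt M k₃.1 = matsubaraInt M k₂.1 + matsubaraInt M k₄.1 ∧
            k₁.2 + k₃.2 = k₂.2 + k₄.2 then psiPlus k₁ 0 * psiMinus k₂ 0 * psiPlus k₃ 1 * psiMinus k₄ 1 else 0) =
        (if matsubaraInt M (rotFreqMomentum k₁).1 + matsubaraInt M (rotFreqMomentum k₃).1 =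
              matsubaraInt M (rotFreqMomentum k₂).1 + matsubaraInt M (rotFreqMomentum k₄).1 ∧
            (rotFreqMomentum k₁).2 + (rotFreqMomentum k₃).2 = (rotFreqMomentum k₂).2 + (rotFreqMomentum k₄).2 then
          psiPlus (rotFreqMomentum k₁) 0 * psiMinus (rotFreqMomentum k₂) 0 * psiPlus (rotFreqMomentum k₃) 1 *
            psiMinus (rotFreqMomentum k₄) 1 else 0) := by
    intro k₁ k₂ k₃ k₄
    have hiff : (matsubaraInt M k₁.1 + matsubaraInt M k₃.1 = matsubaraInt M k₂.1 + matsubaraInt M k₄.1 ∧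
        k₁.2 + k₃.2 = k₂.2 + k₄.2) ↔
        (matsubaraInt M (rotFreqMomentum k₁).1 + matsubaraInt M (rotFreqMomentum k₃).1 =
              matsubaraInt M (rotFreqMomentum k₂).1 + matsubaraInt M (rotFreqMomentum k₄).1 ∧
            (rotFreqMomentum k₁).2 + (rotFreqMomentum k₃).2 = (rotFreqMomentum k₂).2 + (rotFreqMomentum k₄).2) := by
      simp only [rotFreqMomentum_apply]
      rw [← rotSite_add, ← rotSite_add]
      exact and_congr Iff.rfl ⟨fun h => by rw [h], fun h => rotSiteEquiv.injective h⟩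
    by_cases hc : matsubaraInt M k₁.1 + matsubaraInt M k₃.1 = matsubaraInt M k₂.1 + matsubaraInt M k₄.1 ∧
        k₁.2 + k₃.2 = k₂.2 + k₄.2
    · rw [if_pos hc, if_pos (hiff.1 hc), map_mul, map_mul, map_mul, map_rotLabel_psiPlus, map_rotLabel_psiMinus,
        map_rotLabel_psiPlus, map_rotLabel_psiMinus]
    · rw [if_neg hc, if_neg (fun h => hc (hiff.2 h)), map_zero]
  simp only [hsum]
  exact Fintype.sum_equiv rotFreqMomentum _ _ fun k₁ => Fintype.sum_equiv rotFreqMomentum _ _ fun k₂ =>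
    Fintype.sum_equiv rotFreqMomentum _ _ fun k₃ => Fintype.sum_equiv rotFreqMomentum _ _ fun k₄ => rfl

/-- **The counterterm of every frame is rotation invariant** (`K(p(rot k⃗)) = K(p(k⃗))`). [folklore] -/
theorem map_rotLabel_counterQuadratic (β : ℝ) (K : TrigPolyC4v) :
    ExteriorAlgebra.map (relabel ℂ (rotLabel (L := L) (M := M))) (counterQuadratic L M β K) =
      counterQuadratic L M β K := by
  unfold counterQuadratic
  simp only [map_sum, map_smul, map_mul, map_rotLabel_psiPlus, map_rotLabel_psiMinus]
  refine Fintype.sum_equiv rotFreqMomentum _ _ fun k => Finset.sum_congr rfl fun σ _ => ?_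
  simp only [rotFreqMomentum_apply, eval_latticeMomentum_rotSite]

/-- **The countertermed effective action at zero seed is rotation invariant**, for every `U`, `μ`,
frame, scale and `(L, M, β)`. [folklore] -/
theorem map_rotLabel_hubbardEffectiveActionCT (β U μ : ℝ) (K : TrigPolyC4v) (Λ : ℝ) :
    ExteriorAlgebra.map (relabel ℂ (rotLabel (L := L) (M := M))) (hubbardEffectiveActionCT L M β U μ 0 K Λ) =
      hubbardEffectiveActionCT L M β U μ 0 K Λ := by
  rw [hubbardEffectiveActionCT]
  refine map_relabel_effAction ℂ (fun X Y => hubbardCovAboveCT_rotLabel β μ K Λ X Y)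
    (isNilpotent_hubbardInteractionCT L M β U K) ?_
  rw [hubbardInteractionCT, map_add, map_rotLabel_hubbardInteraction, map_rotLabel_counterQuadratic]

/-- Vertex functions of the CT effective action are rotation invariant. [folklore] -/
theorem vertexFn_hubbardCT_rotLabel (β U μ : ℝ) (K : TrigPolyC4v) (Λ : ℝ) (m : ℕ) (X : Fin m → HubbardFieldIdx L M) :
    vertexFn L M β (hubbardEffectiveActionCT L M β U μ 0 K Λ) m (fun i => rotLabel (X i)) =
      vertexFn L M β (hubbardEffectiveActionCT L M β U μ 0 K Λ) m X := by
  rw [vertexFn, vertexFn, kernel_comp_perm_of_map_relabel_eq ℂ (map_rotLabel_hubbardEffectiveActionCT β U μ K Λ)]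

variable [NeZero M]

omit [NeZero M] in
/-- **The self-energy of the CT effective action is rotation invariant.** [folklore] -/
theorem selfEnergy_hubbardCT_rotSite (β U μ : ℝ) (K : TrigPolyC4v) (Λ : ℝ) (ω : MatsubaraIdx M) (k : TorusSite 2 L)
    (σ : Fin 2) :
    selfEnergy L M β (hubbardEffectiveActionCT L M β U μ 0 K Λ) (ω, rotSite k) σ =
      selfEnergy L M β (hubbardEffectiveActionCT L M β U μ 0 K Λ) (ω, k) σ := by
  have h := vertexFn_hubbardCT_rotLabel β U μ K Λ 2 ![(((ω, k), σ), 0), (((ω, k), σ), 1)]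
  have hX : (fun i => rotLabel (![(((ω, k), σ), 0), (((ω, k), σ), 1)] i)) =
      ![(((ω, rotSite k), σ), 0), (((ω, rotSite k), σ), 1)] := by
    funext i
    fin_cases i <;> rfl
  rw [hX] at h
  rw [selfEnergy, selfEnergy]
  exact h

/-- The field strengths of the CT effective action are rotation invariant. [folklore] -/
theorem fieldStrength_hubbardCT_rotSite (β U μ : ℝ) (K : TrigPolyC4v) (Λ : ℝ) (k : TorusSite 2 L) :
    fieldStrength L M β (hubbardEffectiveActionCT L M β U μ 0 K Λ) (rotSite k) =
      fieldStrength L M β (hubbardEffectiveActionCT L M β U μ 0 K Λ) k := by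
  simp only [fieldStrength, fieldStrengthSpin, selfEnergy_hubbardCT_rotSite]

/-- **The BCS shell measure of the CT effective action is rotation invariant.** [folklore] -/
theorem bcsMeasure_hubbardCT_rotSite (β U μ : ℝ) (K : TrigPolyC4v) (Λ Λ' : ℝ) (k : TorusSite 2 L) :
    bcsMeasure L M β Λ' (hubbardEffectiveActionCT L M β U μ 0 K Λ) (rotSite k) =
      bcsMeasure L M β Λ' (hubbardEffectiveActionCT L M β U μ 0 K Λ) k := by
  rw [bcsMeasure, bcsMeasure, ← rotSite_neg', fieldStrength_hubbardCT_rotSite, fieldStrength_hubbardCT_rotSite]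

/-- **The Cooper amplitude of the CT effective action is rotation covariant**: `𝒞(rot k⃗, rot k⃗') = 𝒞(k⃗, k⃗')`.
[folklore] -/
theorem cooperAmplitude_hubbardCT_rotSite (β U μ : ℝ) (K : TrigPolyC4v) (Λ : ℝ) (k k' : TorusSite 2 L) :
    cooperAmplitude L M β (hubbardEffectiveActionCT L M β U μ 0 K Λ) (rotSite k) (rotSite k') =
      cooperAmplitude L M β (hubbardEffectiveActionCT L M β U μ 0 K Λ) k k' := by
  have h := vertexFn_hubbardCT_rotLabel β U μ K Λ 4
    ![(((omega0 M, k'), 0), 0), ((FreqMomentum.neg (omega0 M, k'), 1), 0),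
      ((FreqMomentum.neg (omega0 M, k), 1), 1), (((omega0 M, k), 0), 1)]
  have hX : (fun i => rotLabel (![(((omega0 M, k'), 0), 0), ((FreqMomentum.neg (omega0 M, k'), 1), 0),
      ((FreqMomentum.neg (omega0 M, k), 1), 1), (((omega0 M, k), 0), 1)] i)) =
      ![(((omega0 M, rotSite k'), 0), 0), ((FreqMomentum.neg (omega0 M, rotSite k'), 1), 0),
        ((FreqMomentum.neg (omega0 M, rotSite k), 1), 1), (((omega0 M, rotSite k), 0), 1)] := by
    funext i
    fin_cases i
    · rfl
    · show ((rotFreqMomentum (FreqMomentum.neg (omega0 M, k')), 1), 0) = _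
      rw [rotFreqMomentum_neg]; rfl
    · show ((rotFreqMomentum (FreqMomentum.neg (omega0 M, k)), 1), 1) = _
      rw [rotFreqMomentum_neg]; rfl
    · rfl
  rw [hX] at h
  rw [cooperAmplitude, cooperAmplitude]
  exact h

end Rotation

/-! ## §9 F: The `B₁g`-blind oscillation bound, unconditional for the countertermed Hubbard action -/

section Oscillation

variable {L M : ℕ} [NeZero L] [NeZero M]

/-- **Unconditional `B₁g`-blind bound for the model.**  For the countertermed Hubbard effective action at
zero seed (any `U`, `μ`, frame `K`, scales, `(L, M, β)`), under clause (ii′)-Cooper, for EVERY constant `c`: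
`λ_d ≤ (sup_{S_Λ × S_Λ} ‖𝒞 - c‖) · Σ_{S_Λ} (√ν)²` — the hypotheses of `pairingStrength_le_of_amplitude_sub_const_le`
hold by rotation covariance (`nambuXiCT_rotSite`, `bcsMeasure_hubbardCT_rotSite`). [folklore] -/
theorem pairingStrength_hubbardCT_le_of_amplitude_sub_const_le (β U μ : ℝ) (K : TrigPolyC4v) (Λ Λ' : ℝ)
    (hdom : CooperDominance (cooperMatrix L M β (nambuXiCT L μ K) Λ' (hubbardEffectiveActionCT L M β U μ 0 K Λ)))
    (c : ℂ) {C : ℝ} (hC : 0 ≤ C)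
    (hamp : ∀ k ∈ momentumShell L (nambuXiCT L μ K) Λ', ∀ k' ∈ momentumShell L (nambuXiCT L μ K) Λ',
      ‖cooperAmplitude L M β (hubbardEffectiveActionCT L M β U μ 0 K Λ) k k' - c‖ ≤ C) :
    pairingStrength L M β (nambuXiCT L μ K) Λ' (hubbardEffectiveActionCT L M β U μ 0 K Λ) ≤
      C * ∑ k ∈ momentumShell L (nambuXiCT L μ K) Λ',
        Real.sqrt (bcsMeasure L M β Λ' (hubbardEffectiveActionCT L M β U μ 0 K Λ) k) ^ 2 :=
  pairingStrength_le_of_amplitude_sub_const_le β Λ' _ _ hdom (nambuXiCT_rotSite μ K)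
    (bcsMeasure_hubbardCT_rotSite β U μ K Λ Λ') c hC hamp

/-- **Oscillation necessary condition (point form).**  At every certified `(L, M, β)` of the countertermed
Hubbard action at its own scale `Λ`, for EVERY constant `c ∈ ℂ` and every bound `C` of `‖𝒞 - c‖` on
`S_Λ × S_Λ`: `a · 2ζΛL² ≤ C · |S_Λ|` — the certified Cooper amplitude deviates from every constant by at
least `2aζΛL²/|S_Λ|` (`= ΛL²/(8|S_Λ|) ≥ Λ/8` at `π₀`; physically `≈ (1/8)/Σν ≈ 0.66`). [folklore] -/
theorem cooperAmplitude_osc_lower_bound {π : SymmetricRegimeDataT} {Θ : SymmetricTolerance} {a b : ℚ}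
    {β U μ Λ : ℝ} {K : TrigPolyC4v}
    (h : SymmetricCertifiedAtT π Θ a b Λ L M β (nambuXiCT L μ K) (hubbardEffectiveActionCT L M β U μ 0 K Λ)
      (hubbardEffPartitionFnCT L M β U μ 0 K Λ)) (hΛ : 0 < Λ)
    (c : ℂ) {C : ℝ} (hC : 0 ≤ C)
    (hamp : ∀ k ∈ momentumShell L (nambuXiCT L μ K) Λ, ∀ k' ∈ momentumShell L (nambuXiCT L μ K) Λ,
      ‖cooperAmplitude L M β (hubbardEffectiveActionCT L M β U μ 0 K Λ) k k' - c‖ ≤ C) :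
    (a : ℝ) * (2 * π.fieldFloor * Λ * (L : ℝ) ^ 2) ≤ C * (momentumShell L (nambuXiCT L μ K) Λ).card := by
  set S := momentumShell L (nambuXiCT L μ K) Λ
  set G := hubbardEffectiveActionCT L M β U μ 0 K Λ
  have hζ : (0 : ℝ) < π.fieldFloor := by exact_mod_cast π.fieldFloor_pos
  have hz : ∀ k ∈ S, (π.fieldFloor : ℝ) ≤ fieldStrength L M β G k := fun k hk => by
    have h0 := (h.fieldStrength_mem hk 0).1
    have h1 := (h.fieldStrength_mem hk 1).1
    unfold fieldStrength
    linarith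
  have hneg : ∀ k ∈ S, -k ∈ S := fun k hk => by
    rw [mem_momentumShell] at hk ⊢
    rwa [nambuXiCT_neg]
  have hν : ∀ k ∈ S, Real.sqrt (bcsMeasure L M β Λ G k) ^ 2 ≤ 1 / (2 * π.fieldFloor * Λ * (L : ℝ) ^ 2) := by
    intro k hk
    obtain ⟨h0, h1⟩ := bcsMeasure_mem_of_fieldStrength hΛ hζ (hz k hk) (hz (-k) (hneg k hk))
    rw [Real.sq_sqrt h0]
    exact h1
  have hsum : ∑ k ∈ S, Real.sqrt (bcsMeasure L M β Λ G k) ^ 2 ≤ S.card * (1 / (2 * π.fieldFloor * Λ * (L : ℝ) ^ 2)) :=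
    (Finset.sum_le_sum hν).trans (by rw [Finset.sum_const, nsmul_eq_mul])
  have hchain : (a : ℝ) ≤ C * (S.card * (1 / (2 * π.fieldFloor * Λ * (L : ℝ) ^ 2))) :=
    calc (a : ℝ) ≤ pairingStrength L M β (nambuXiCT L μ K) Λ G := h.window.1
      _ ≤ C * ∑ k ∈ S, Real.sqrt (bcsMeasure L M β Λ G k) ^ 2 :=
        pairingStrength_hubbardCT_le_of_amplitude_sub_const_le β U μ K Λ Λ h.cooperDominance c hC hamp
      _ ≤ C * (S.card * (1 / (2 * π.fieldFloor * Λ * (L : ℝ) ^ 2))) := mul_le_mul_of_nonneg_left hsum hC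
  have hD : 0 < 2 * (π.fieldFloor : ℝ) * Λ * (L : ℝ) ^ 2 := by
    have hL : (0 : ℝ) < (L : ℝ) ^ 2 := pow_pos (by exact_mod_cast NeZero.pos L) 2
    positivity
  rw [show C * (S.card * (1 / (2 * π.fieldFloor * Λ * (L : ℝ) ^ 2))) =
      C * S.card / (2 * π.fieldFloor * Λ * (L : ℝ) ^ 2) by ring] at hchain
  exact (le_div_iff₀ hD).1 hchain

/-- **Oscillation necessary condition at the pinned data `π₀`**: under
`symmetricRegimeCertificateT U μ capRgCornerDataT Θ K Λ L₀`, for every `L ≥ L₀` there are `β, M` (all large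
ones) at which, for EVERY constant `c`, the Cooper amplitude of `hubbardEffectiveActionCT L M β U μ 0 K Λ`
satisfies `sup_{S_Λ×S_Λ} ‖𝒞 - c‖ ≥ Λ L² / (8 |S_Λ|)`: a certified Cooper amplitude is never shell-constant,
quantitatively. [folklore] -/
theorem cooperAmplitude_osc_of_certificateT {U μ : ℝ} {Θ : SymmetricTolerance} {K : TrigPolyC4v} {Λ : ℝ}
    {L₀ : ℕ} (h : symmetricRegimeCertificateT U μ capRgCornerDataT Θ K Λ L₀) :
    ∀ L : ℕ, L₀ ≤ L → ∀ [NeZero L], ∃ β₀ : ℝ, ∀ β : ℝ, β₀ ≤ β → ∃ M₀ : ℕ, ∀ M : ℕ, M₀ ≤ M → ∀ [NeZero M],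
      ∀ (c : ℂ) (C : ℝ), 0 ≤ C →
        (∀ k ∈ momentumShell L (nambuXiCT L μ K) Λ, ∀ k' ∈ momentumShell L (nambuXiCT L μ K) Λ,
          ‖cooperAmplitude L M β (hubbardEffectiveActionCT L M β U μ 0 K Λ) k k' - c‖ ≤ C) →
        Λ * (L : ℝ) ^ 2 / 8 ≤ C * (momentumShell L (nambuXiCT L μ K) Λ).card := by
  intro L hL _
  obtain ⟨-, hΛ, -, a, b, ha, -, -, -, hblock⟩ := h
  obtain ⟨β₀, hβ₀⟩ := hblock L hL
  refine ⟨β₀, fun β hβ => ?_⟩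
  obtain ⟨M₀, hM₀⟩ := hβ₀ β hβ
  refine ⟨M₀, fun M hM _ c C hC hamp => ?_⟩
  have key := cooperAmplitude_osc_lower_bound (hM₀ M hM) hΛ.pos c hC hamp
  have hf : ((capRgCornerDataT.fieldFloor : ℚ) : ℝ) = 1 / 2 := by
    rw [capRgCornerDataT_bounds.2.2.1]; norm_num
  rw [hf] at key
  have ha' : (1 / 8 : ℝ) ≤ a := by
    have := (Rat.cast_le (K := ℝ)).2 ha
    simpa [symmetricWindowLower] using this
  have hΛL : 0 ≤ Λ * (L : ℝ) ^ 2 := mul_nonneg hΛ.pos.le (sq_nonneg _)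
  nlinarith

end Oscillation


/-! ## §10 (cycle 2) The `B₁g` bottom is blind to every ONE-SIDED rotation-invariant kernel -/

section OneSided

variable {L M : ℕ} [NeZero L] [NeZero M]

/-- **The `B₁g` bottom is blind to one-sided rotation-invariant kernels.**  Under clause (ii′)-Cooper, with a
rotation-invariant band and BCS weight, for all kernels `Q₁` (rotation invariant in the first argument) and
`Q₂` (rotation invariant in the second argument) and every bound `C` of `‖𝒞 - Q₁ - Q₂‖` on `S_Λ × S_Λ`:
`λ_d ≤ C · Σ_{S_Λ} (√ν)²`. [folklore] -/
theorem pairingStrength_le_of_amplitude_sub_oneSided_le (β Λ : ℝ) (e : TorusSite 2 L → ℝ)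
    (G : HubbardGrassmann L M) (hdom : CooperDominance (cooperMatrix L M β e Λ G))
    (he : ∀ k, e (rotSite k) = e k)
    (hν : ∀ k, bcsMeasure L M β Λ G (rotSite k) = bcsMeasure L M β Λ G k)
    (Q₁ Q₂ : TorusSite 2 L → TorusSite 2 L → ℂ)
    (hQ₁ : ∀ k k', Q₁ (rotSite k) k' = Q₁ k k') (hQ₂ : ∀ k k', Q₂ k (rotSite k') = Q₂ k k')
    {C : ℝ} (hC : 0 ≤ C)
    (hamp : ∀ k ∈ momentumShell L e Λ, ∀ k' ∈ momentumShell L e Λ,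
      ‖cooperAmplitude L M β G k k' - Q₁ k k' - Q₂ k k'‖ ≤ C) :
    pairingStrength L M β e Λ G ≤
      C * ∑ k ∈ momentumShell L e Λ, Real.sqrt (bcsMeasure L M β Λ G k) ^ 2 := by
  classical
  obtain ⟨f, hf1, hB, hbottom, -⟩ := hdom
  set S := momentumShell L e Λ with hSdef
  set s : TorusSite 2 L → ℂ := fun k => ((Real.sqrt (bcsMeasure L M β Λ G k) : ℝ) : ℂ) with hsdef
  have hSrot : ∀ k, rotSite k ∈ S ↔ k ∈ S := fun k => by
    simp only [hSdef, mem_momentumShell, he]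
  have hfodd := rot_odd_of_isB1g hB
  -- the two one-sided vanishing sums
  have hT₂ : ∀ k, ∑ k' ∈ S, s k' * (Q₂ k k' * f k') = 0 := fun k =>
    sum_sqrt_mul_eq_zero_of_rot_odd S _ (fun k' => Q₂ k k' * f k') hSrot hν fun k' => by
      rw [hQ₂, hfodd]; ring
  have hT₁ : ∀ k', ∑ k ∈ S, s k * (conj (f k) * Q₁ k k') = 0 := fun k' =>
    sum_sqrt_mul_eq_zero_of_rot_odd S _ (fun k => conj (f k) * Q₁ k k') hSrot hν fun k => by
      rw [hQ₁, hfodd, map_neg]; ring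
  let Atil : Matrix (TorusSite 2 L) (TorusSite 2 L) ℂ := Matrix.of fun k k' =>
    if k ∈ S ∧ k' ∈ S then s k * (cooperAmplitude L M β G k k' - Q₁ k k' - Q₂ k k') * s k' else 0
  let P₁ : Matrix (TorusSite 2 L) (TorusSite 2 L) ℂ := Matrix.of fun k k' =>
    if k ∈ S ∧ k' ∈ S then s k * Q₁ k k' * s k' else 0
  let P₂ : Matrix (TorusSite 2 L) (TorusSite 2 L) ℂ := Matrix.of fun k k' =>
    if k ∈ S ∧ k' ∈ S then s k * Q₂ k k' * s k' else 0
  have hsplit : cooperMatrix L M β e Λ G = Atil + P₁ + P₂ := by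
    ext k k'
    simp only [cooperMatrix, Matrix.of_apply, Matrix.add_apply, Atil, P₁, P₂, ← hSdef, hsdef]
    split_ifs <;> ring
  -- `P₂ f = 0`
  have hP₂f : P₂ *ᵥ f = 0 := by
    ext k
    simp only [Matrix.mulVec, dotProduct, Matrix.of_apply, Pi.zero_apply, P₂]
    by_cases hk : k ∈ S
    · have : ∀ k', (if k ∈ S ∧ k' ∈ S then s k * Q₂ k k' * s k' else 0) * f k' =
          s k * (if k' ∈ S then s k' * (Q₂ k k' * f k') else 0) := fun k' => by
        by_cases hk' : k' ∈ S
        · rw [if_pos ⟨hk, hk'⟩, if_pos hk']; ring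
        · rw [if_neg (fun h => hk' h.2), if_neg hk']; ring
      simp_rw [this]
      rw [← Finset.mul_sum, Finset.sum_ite_mem, Finset.univ_inter, hT₂ k, mul_zero]
    · refine Finset.sum_eq_zero fun k' _ => ?_
      rw [if_neg (fun h => hk h.1), zero_mul]
  -- `⟨f, P₁ f⟩ = 0`
  have hP₁f : star f ⬝ᵥ (P₁ *ᵥ f) = 0 := by
    simp only [Matrix.mulVec, dotProduct, Matrix.of_apply, P₁, Pi.star_apply, Complex.star_def, Finset.mul_sum]
    rw [Finset.sum_comm]
    refine Finset.sum_eq_zero fun k' _ => ?_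
    by_cases hk' : k' ∈ S
    · have : ∀ k, conj (f k) * ((if k ∈ S ∧ k' ∈ S then s k * Q₁ k k' * s k' else 0) * f k') =
          (s k' * f k') * (if k ∈ S then s k * (conj (f k) * Q₁ k k') else 0) := fun k => by
        by_cases hk : k ∈ S
        · rw [if_pos ⟨hk, hk'⟩, if_pos hk]; ring
        · rw [if_neg (fun h => hk h.1), if_neg hk]; ring
      simp_rw [this]
      rw [← Finset.mul_sum, Finset.sum_ite_mem, Finset.univ_inter, hT₁ k', mul_zero]
    · refine Finset.sum_eq_zero fun k _ => ?_
      rw [if_neg (fun h => hk' h.2), zero_mul, mul_zero]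
  have hre : reRayleigh (cooperMatrix L M β e Λ G) f = (star f ⬝ᵥ (Atil *ᵥ f)).re := by
    rw [reRayleigh, hsplit, Matrix.add_mulVec, Matrix.add_mulVec, hP₂f, add_zero, dotProduct_add, hP₁f, add_zero]
  have hA : ∀ k k', ‖Atil k k'‖ ≤
      (fun j => if j ∈ S then Real.sqrt (bcsMeasure L M β Λ G j) else 0) k * C *
        (fun j => if j ∈ S then Real.sqrt (bcsMeasure L M β Λ G j) else 0) k' := fun k k' => by
    simp only [Atil, Matrix.of_apply, hsdef]
    convert norm_sandwich_le (S := S) (w := bcsMeasure L M β Λ G)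
      (F := fun k k' => cooperAmplitude L M β G k k' - Q₁ k k' - Q₂ k k') hamp k k' using 3
  have key := re_neg_rayleigh_le_of_entry_bound Atil _ C hC hA hf1
  rw [Matrix.neg_mulVec, dotProduct_neg, Complex.neg_re, sum_indicator_sqrt_sq] at key
  have hlam : pairingStrength L M β e Λ G = -reRayleigh (cooperMatrix L M β e Λ G) f := by
    rw [hbottom, neg_neg, pairingStrength]
  rw [hlam, hre]
  exact key

/-- **Additively separable amplitudes certify nothing**: if `𝒞(k⃗, k⃗') = g(k⃗) + h(k⃗')` on the shell (any
`g`, `h`), a `G` with rotation-invariant band and BCS weight and Cooper dominance has `λ_d ≤ 0`, so no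
certificate with `a > 0`. [folklore] -/
theorem not_symmetricCertifiedAtT_of_cooperAmplitude_additive {π : SymmetricRegimeDataT}
    {Θ : SymmetricTolerance} {a b : ℚ} (ha : 0 < a) {Λ β : ℝ} {e : TorusSite 2 L → ℝ}
    {G : HubbardGrassmann L M} {Z : ℂ} (g h : TorusSite 2 L → ℂ)
    (he : ∀ k, e (rotSite k) = e k)
    (hν : ∀ k, bcsMeasure L M β Λ G (rotSite k) = bcsMeasure L M β Λ G k)
    (hadd : ∀ k ∈ momentumShell L e Λ, ∀ k' ∈ momentumShell L e Λ, cooperAmplitude L M β G k k' = g k + h k') :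
    ¬ SymmetricCertifiedAtT π Θ a b Λ L M β e G Z := by
  intro hc
  have h1 := hc.window.1
  have h2 := pairingStrength_le_of_amplitude_sub_oneSided_le β Λ e G hc.cooperDominance he hν
    (fun _ k' => h k') (fun k _ => g k) (fun _ _ => rfl) (fun _ _ => rfl) (le_refl (0 : ℝ))
    (fun k hk k' hk' => by rw [hadd k hk k' hk']; ring_nf; simp)
  rw [zero_mul] at h2
  have : (0 : ℝ) < a := by exact_mod_cast ha
  linarith

/-- **Model form**: for the countertermed Hubbard effective action at zero seed the hypotheses `he`, `hν` hold
(`RotationCovariance.lean`), so under clause (ii′)-Cooper `λ_d ≤ (sup ‖𝒞 - Q₁ - Q₂‖) · Σ (√ν)²` for all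
one-sided rotation-invariant `Q₁`, `Q₂`. [folklore] -/
theorem pairingStrength_hubbardCT_le_of_amplitude_sub_oneSided_le (β U μ : ℝ) (K : TrigPolyC4v) (Λ Λ' : ℝ)
    (hdom : CooperDominance (cooperMatrix L M β (nambuXiCT L μ K) Λ' (hubbardEffectiveActionCT L M β U μ 0 K Λ)))
    (Q₁ Q₂ : TorusSite 2 L → TorusSite 2 L → ℂ)
    (hQ₁ : ∀ k k', Q₁ (rotSite k) k' = Q₁ k k') (hQ₂ : ∀ k k', Q₂ k (rotSite k') = Q₂ k k')
    {C : ℝ} (hC : 0 ≤ C)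
    (hamp : ∀ k ∈ momentumShell L (nambuXiCT L μ K) Λ', ∀ k' ∈ momentumShell L (nambuXiCT L μ K) Λ',
      ‖cooperAmplitude L M β (hubbardEffectiveActionCT L M β U μ 0 K Λ) k k' - Q₁ k k' - Q₂ k k'‖ ≤ C) :
    pairingStrength L M β (nambuXiCT L μ K) Λ' (hubbardEffectiveActionCT L M β U μ 0 K Λ) ≤
      C * ∑ k ∈ momentumShell L (nambuXiCT L μ K) Λ',
        Real.sqrt (bcsMeasure L M β Λ' (hubbardEffectiveActionCT L M β U μ 0 K Λ) k) ^ 2 :=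
  pairingStrength_le_of_amplitude_sub_oneSided_le β Λ' _ _ hdom (nambuXiCT_rotSite μ K)
    (bcsMeasure_hubbardCT_rotSite β U μ K Λ Λ') Q₁ Q₂ hQ₁ hQ₂ hC hamp

/-- **One-sided distance necessary condition (point form).**  At every certified `(L, M, β)` of the
countertermed Hubbard action at its own scale `Λ`, for all one-sided rotation-invariant `Q₁`, `Q₂` and every
bound `C` of `‖𝒞 - Q₁ - Q₂‖` on `S_Λ × S_Λ`: `a · 2ζΛL² ≤ C · |S_Λ|`. [folklore] -/
theorem cooperAmplitude_oneSided_dist_lower_bound {π : SymmetricRegimeDataT} {Θ : SymmetricTolerance} {a b : ℚ}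
    {β U μ Λ : ℝ} {K : TrigPolyC4v}
    (h : SymmetricCertifiedAtT π Θ a b Λ L M β (nambuXiCT L μ K) (hubbardEffectiveActionCT L M β U μ 0 K Λ)
      (hubbardEffPartitionFnCT L M β U μ 0 K Λ)) (hΛ : 0 < Λ)
    (Q₁ Q₂ : TorusSite 2 L → TorusSite 2 L → ℂ)
    (hQ₁ : ∀ k k', Q₁ (rotSite k) k' = Q₁ k k') (hQ₂ : ∀ k k', Q₂ k (rotSite k') = Q₂ k k')
    {C : ℝ} (hC : 0 ≤ C)
    (hamp : ∀ k ∈ momentumShell L (nambuXiCT L μ K) Λ, ∀ k' ∈ momentumShell L (nambuXiCT L μ K) Λ,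
      ‖cooperAmplitude L M β (hubbardEffectiveActionCT L M β U μ 0 K Λ) k k' - Q₁ k k' - Q₂ k k'‖ ≤ C) :
    (a : ℝ) * (2 * π.fieldFloor * Λ * (L : ℝ) ^ 2) ≤ C * (momentumShell L (nambuXiCT L μ K) Λ).card := by
  set S := momentumShell L (nambuXiCT L μ K) Λ
  set G := hubbardEffectiveActionCT L M β U μ 0 K Λ
  have hζ : (0 : ℝ) < π.fieldFloor := by exact_mod_cast π.fieldFloor_pos
  have hz : ∀ k ∈ S, (π.fieldFloor : ℝ) ≤ fieldStrength L M β G k := fun k hk => by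
    have h0 := (h.fieldStrength_mem hk 0).1
    have h1 := (h.fieldStrength_mem hk 1).1
    unfold fieldStrength
    linarith
  have hneg : ∀ k ∈ S, -k ∈ S := fun k hk => by
    rw [mem_momentumShell] at hk ⊢
    rwa [nambuXiCT_neg]
  have hν : ∀ k ∈ S, Real.sqrt (bcsMeasure L M β Λ G k) ^ 2 ≤ 1 / (2 * π.fieldFloor * Λ * (L : ℝ) ^ 2) := by
    intro k hk
    obtain ⟨h0, h1⟩ := bcsMeasure_mem_of_fieldStrength hΛ hζ (hz k hk) (hz (-k) (hneg k hk))
    rw [Real.sq_sqrt h0]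
    exact h1
  have hsum : ∑ k ∈ S, Real.sqrt (bcsMeasure L M β Λ G k) ^ 2 ≤ S.card * (1 / (2 * π.fieldFloor * Λ * (L : ℝ) ^ 2)) :=
    (Finset.sum_le_sum hν).trans (by rw [Finset.sum_const, nsmul_eq_mul])
  have hchain : (a : ℝ) ≤ C * (S.card * (1 / (2 * π.fieldFloor * Λ * (L : ℝ) ^ 2))) :=
    calc (a : ℝ) ≤ pairingStrength L M β (nambuXiCT L μ K) Λ G := h.window.1
      _ ≤ C * ∑ k ∈ S, Real.sqrt (bcsMeasure L M β Λ G k) ^ 2 :=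
        pairingStrength_hubbardCT_le_of_amplitude_sub_oneSided_le β U μ K Λ Λ h.cooperDominance Q₁ Q₂ hQ₁ hQ₂ hC hamp
      _ ≤ C * (S.card * (1 / (2 * π.fieldFloor * Λ * (L : ℝ) ^ 2))) := mul_le_mul_of_nonneg_left hsum hC
  have hD : 0 < 2 * (π.fieldFloor : ℝ) * Λ * (L : ℝ) ^ 2 := by
    have hL : (0 : ℝ) < (L : ℝ) ^ 2 := pow_pos (by exact_mod_cast NeZero.pos L) 2
    positivity
  rw [show C * (S.card * (1 / (2 * π.fieldFloor * Λ * (L : ℝ) ^ 2))) =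
      C * S.card / (2 * π.fieldFloor * Λ * (L : ℝ) ^ 2) by ring] at hchain
  exact (le_div_iff₀ hD).1 hchain

/-- **One-sided distance necessary condition at the pinned data `π₀`**: under
`symmetricRegimeCertificateT U μ capRgCornerDataT Θ K Λ L₀`, for every `L ≥ L₀` and all large `β`, `M`, the
Cooper amplitude of `hubbardEffectiveActionCT L M β U μ 0 K Λ` is at sup-distance at least `ΛL²/(8|S_Λ|)` on
`S_Λ × S_Λ` from EVERY kernel `Q₁ + Q₂` with `Q₁` rotation invariant in `k⃗` and `Q₂` in `k⃗'`. [folklore] -/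
theorem cooperAmplitude_oneSided_dist_of_certificateT {U μ : ℝ} {Θ : SymmetricTolerance} {K : TrigPolyC4v}
    {Λ : ℝ} {L₀ : ℕ} (h : symmetricRegimeCertificateT U μ capRgCornerDataT Θ K Λ L₀) :
    ∀ L : ℕ, L₀ ≤ L → ∀ [NeZero L], ∃ β₀ : ℝ, ∀ β : ℝ, β₀ ≤ β → ∃ M₀ : ℕ, ∀ M : ℕ, M₀ ≤ M → ∀ [NeZero M],
      ∀ (Q₁ Q₂ : TorusSite 2 L → TorusSite 2 L → ℂ),
        (∀ k k', Q₁ (rotSite k) k' = Q₁ k k') → (∀ k k', Q₂ k (rotSite k') = Q₂ k k') →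
        ∀ C : ℝ, 0 ≤ C →
        (∀ k ∈ momentumShell L (nambuXiCT L μ K) Λ, ∀ k' ∈ momentumShell L (nambuXiCT L μ K) Λ,
          ‖cooperAmplitude L M β (hubbardEffectiveActionCT L M β U μ 0 K Λ) k k' - Q₁ k k' - Q₂ k k'‖ ≤ C) →
        Λ * (L : ℝ) ^ 2 / 8 ≤ C * (momentumShell L (nambuXiCT L μ K) Λ).card := by
  intro L hL _
  obtain ⟨-, hΛ, -, a, b, ha, -, -, -, hblock⟩ := h
  obtain ⟨β₀, hβ₀⟩ := hblock L hL
  refine ⟨β₀, fun β hβ => ?_⟩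
  obtain ⟨M₀, hM₀⟩ := hβ₀ β hβ
  refine ⟨M₀, fun M hM _ Q₁ Q₂ hQ₁ hQ₂ C hC hamp => ?_⟩
  have key := cooperAmplitude_oneSided_dist_lower_bound (hM₀ M hM) hΛ.pos Q₁ Q₂ hQ₁ hQ₂ hC hamp
  have hf : ((capRgCornerDataT.fieldFloor : ℚ) : ℝ) = 1 / 2 := by
    rw [capRgCornerDataT_bounds.2.2.1]; norm_num
  rw [hf] at key
  have ha' : (1 / 8 : ℝ) ≤ a := by
    have := (Rat.cast_le (K := ℝ)).2 ha
    simpa [symmetricWindowLower] using this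
  have hΛL : 0 ≤ Λ * (L : ℝ) ^ 2 := mul_nonneg hΛ.pos.le (sq_nonneg _)
  nlinarith

end OneSided


/-! ## §10′ (cycle 2) Inversion: `k⃗ ↦ -k⃗` is the rotation by `π`, so the certified functionals are inversion covariant -/

section Inversion

variable {L M : ℕ}

/-- Two quarter turns are the inversion: `rot (rot k⃗) = -k⃗`. [folklore] -/
theorem rotSite_rotSite (k : TorusSite 2 L) : rotSite (rotSite k) = -k := by
  ext i; fin_cases i <;> simp [rotSite]

variable [NeZero L]

/-- The self-energy of the CT effective action is inversion invariant in the momentum. [folklore] -/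
theorem selfEnergy_hubbardCT_neg (β U μ : ℝ) (K : TrigPolyC4v) (Λ : ℝ) (ω : MatsubaraIdx M) (k : TorusSite 2 L)
    (σ : Fin 2) :
    selfEnergy L M β (hubbardEffectiveActionCT L M β U μ 0 K Λ) (ω, -k) σ =
      selfEnergy L M β (hubbardEffectiveActionCT L M β U μ 0 K Λ) (ω, k) σ := by
  rw [← rotSite_rotSite, selfEnergy_hubbardCT_rotSite, selfEnergy_hubbardCT_rotSite]

variable [NeZero M]

/-- The field strengths of the CT effective action are inversion invariant: `z(-k⃗, σ) = z(k⃗, σ)`. [folklore] -/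
theorem fieldStrengthSpin_hubbardCT_neg (β U μ : ℝ) (K : TrigPolyC4v) (Λ : ℝ) (k : TorusSite 2 L) (σ : Fin 2) :
    fieldStrengthSpin L M β (hubbardEffectiveActionCT L M β U μ 0 K Λ) (-k) σ =
      fieldStrengthSpin L M β (hubbardEffectiveActionCT L M β U μ 0 K Λ) k σ := by
  simp only [fieldStrengthSpin, selfEnergy_hubbardCT_neg]

/-- Hence the BCS measure is `ν(k⃗) = 1/(2 Λ L² z(k⃗))` for the model (`z(-k⃗) = z(k⃗)`). [folklore] -/
theorem bcsMeasure_hubbardCT_eq (β U μ : ℝ) (K : TrigPolyC4v) (Λ Λ' : ℝ) (k : TorusSite 2 L) :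
    bcsMeasure L M β Λ' (hubbardEffectiveActionCT L M β U μ 0 K Λ) k =
      1 / (Λ' * (L : ℝ) ^ 2 * (2 * fieldStrength L M β (hubbardEffectiveActionCT L M β U μ 0 K Λ) k)) := by
  rw [bcsMeasure, fieldStrength, fieldStrength, fieldStrengthSpin_hubbardCT_neg, fieldStrengthSpin_hubbardCT_neg]
  ring

/-- **The Cooper amplitude of the CT effective action is inversion covariant**: `𝒞(-k⃗, -k⃗') = 𝒞(k⃗, k⃗')` —
the Cooper matrix commutes with inversion and splits into inversion-even (containing `B₁g`) and odd blocks.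
[folklore] -/
theorem cooperAmplitude_hubbardCT_neg_neg (β U μ : ℝ) (K : TrigPolyC4v) (Λ : ℝ) (k k' : TorusSite 2 L) :
    cooperAmplitude L M β (hubbardEffectiveActionCT L M β U μ 0 K Λ) (-k) (-k') =
      cooperAmplitude L M β (hubbardEffectiveActionCT L M β U μ 0 K Λ) k k' := by
  rw [← rotSite_rotSite, ← rotSite_rotSite k', cooperAmplitude_hubbardCT_rotSite, cooperAmplitude_hubbardCT_rotSite]

end Inversion

/-! ## §11 (cycle 2) Spin-flip covariance of the countertermed effective action -/

section SpinFlip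

variable {L M : ℕ}

/-- **The spin flip on field labels** `(((ω, k⃗), σ), ±) ↦ (((ω, k⃗), 1 - σ), ±)`. [folklore] -/
def spinFlipLabel : Equiv.Perm (HubbardFieldIdx L M) :=
  Equiv.prodCongr (Equiv.prodCongr (Equiv.refl _) Fin.revPerm) (Equiv.refl _)

/-- `spinFlipLabel` in coordinates. [folklore] -/
@[simp] theorem spinFlipLabel_apply (X : HubbardFieldIdx L M) : spinFlipLabel X = ((X.1.1, X.1.2.rev), X.2) := rfl

/-- At zero seed, `G(-k)₁₁ = -G(k)₀₀` for the CT Nambu propagator. [folklore] -/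
theorem nambuPropagatorCT_zero_seed_neg_one_one [NeZero L] (β μ : ℝ) (K : TrigPolyC4v) (k : FreqMomentum L M) :
    nambuPropagatorCT L M β μ 0 K k.neg 1 1 = -nambuPropagatorCT L M β μ 0 K k 0 0 := by
  simp only [nambuPropagatorCT, nambuDenCT, FreqMomentum.neg, matsubaraFreq_rev, nambuXiCT_neg, zero_mul,
    Matrix.of_apply, Matrix.cons_val', Matrix.cons_val_zero, Matrix.cons_val_one, Matrix.empty_val',
    Matrix.cons_val_fin_one]
  push_cast
  ring

/-- **The zero-seed CT two-point function is spin independent**: `⟨ψ⁻_{k↓} ψ⁺_{k↓}⟩ = ⟨ψ⁻_{k↑} ψ⁺_{k↑}⟩`. [folklore] -/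
theorem hubbardTwoPointCT_zero_seed_spin [NeZero L] (β μ : ℝ) (K : TrigPolyC4v) (k : FreqMomentum L M) :
    hubbardTwoPointCT L M β μ 0 K ((k, 1), 1) ((k, 1), 0) = hubbardTwoPointCT L M β μ 0 K ((k, 0), 1) ((k, 0), 0) := by
  have r1 : (1 : Fin 2).rev = 0 := rfl
  have l1 : (Fin.last 1 : Fin 2) = 1 := rfl
  simp only [hubbardTwoPointCT, toNambu, nambuTwoPointCT, Fin.isValue, one_ne_zero, ↓reduceIte, r1, Fin.rev_zero, l1,
    zero_ne_one, and_self, and_true, sub_zero, nambuPropagatorCT_zero_seed_neg_one_one, mul_neg]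
  ring

/-- The zero-seed CT two-point table is spin-flip invariant. [folklore] -/
theorem hubbardTwoPointCT_zero_seed_spinFlip [NeZero L] (β μ : ℝ) (K : TrigPolyC4v) (X Y : HubbardFieldIdx L M) :
    hubbardTwoPointCT L M β μ 0 K (spinFlipLabel X) (spinFlipLabel Y) = hubbardTwoPointCT L M β μ 0 K X Y := by
  by_cases h : X.1 = Y.1 ∧ X.2 ≠ Y.2
  · obtain ⟨h1, h2⟩ := h
    obtain ⟨⟨p, σ⟩, a⟩ := X
    obtain ⟨⟨q, τ⟩, b⟩ := Y
    simp only [Prod.mk.injEq] at h1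
    obtain ⟨rfl, rfl⟩ := h1
    simp only at h2
    have key : ∀ σ : Fin 2, hubbardTwoPointCT L M β μ 0 K ((p, σ), 1) ((p, σ), 0) =
        hubbardTwoPointCT L M β μ 0 K ((p, 0), 1) ((p, 0), 0) := fun σ => by
      rcases Fin.exists_fin_two.1 ⟨σ, rfl⟩ with h0 | h1
      · rw [h0]
      · rw [h1, hubbardTwoPointCT_zero_seed_spin]
    have key' : ∀ σ : Fin 2, hubbardTwoPointCT L M β μ 0 K ((p, σ), 0) ((p, σ), 1) =
        hubbardTwoPointCT L M β μ 0 K ((p, 0), 0) ((p, 0), 1) := fun σ => by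
      rw [hubbardTwoPointCT_swap L M β μ 0 K ((p, σ), 1), key σ, ← hubbardTwoPointCT_swap L M β μ 0 K]
    rcases Fin.exists_fin_two.1 ⟨a, rfl⟩ with ha | ha <;> rcases Fin.exists_fin_two.1 ⟨b, rfl⟩ with hb | hb
    · exact (h2 (ha.trans hb.symm)).elim
    · rw [ha, hb, spinFlipLabel_apply, spinFlipLabel_apply]
      exact (key' _).trans (key' σ).symm
    · rw [ha, hb, spinFlipLabel_apply, spinFlipLabel_apply]
      exact (key _).trans (key σ).symm
    · exact (h2 (ha.trans hb.symm)).elim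
  · have h' : ¬ ((spinFlipLabel X).1 = (spinFlipLabel Y).1 ∧ (spinFlipLabel X).2 ≠ (spinFlipLabel Y).2) := by
      simp only [spinFlipLabel_apply, Prod.mk.injEq, Fin.rev_inj]
      exact fun ⟨⟨h1, h2⟩, h3⟩ => h ⟨Prod.ext h1 h2, h3⟩
    rw [hubbardTwoPointCT_zero_seed_eq_zero β μ K h, hubbardTwoPointCT_zero_seed_eq_zero β μ K h']

/-- **At zero seed the CT covariance above every scale is spin-flip invariant** (every frame). [folklore] -/
theorem hubbardCovAboveCT_spinFlip [NeZero L] (β μ : ℝ) (K : TrigPolyC4v) (Λ : ℝ) (X Y : HubbardFieldIdx L M) :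
    hubbardCovAboveCT L M β μ 0 K Λ (spinFlipLabel X) (spinFlipLabel Y) = hubbardCovAboveCT L M β μ 0 K Λ X Y := by
  rw [hubbardCovAboveCT, Matrix.of_apply, Matrix.of_apply, hubbardCovarianceCT, Matrix.of_apply, Matrix.of_apply,
    hubbardTwoPointCT_zero_seed_spinFlip]
  rfl

/-- The spin flip sends `ψ⁺_{kσ}` to `ψ⁺_{k,1-σ}`. [folklore] -/
theorem map_spinFlip_psiPlus (k : FreqMomentum L M) (σ : Fin 2) :
    ExteriorAlgebra.map (relabel ℂ (spinFlipLabel (L := L) (M := M))) (psiPlus k σ) = psiPlus k σ.rev := by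
  rw [psiPlus, map_relabel_gen, psiPlus]; rfl

/-- The spin flip sends `ψ⁻_{kσ}` to `ψ⁻_{k,1-σ}`. [folklore] -/
theorem map_spinFlip_psiMinus (k : FreqMomentum L M) (σ : Fin 2) :
    ExteriorAlgebra.map (relabel ℂ (spinFlipLabel (L := L) (M := M))) (psiMinus k σ) = psiMinus k σ.rev := by
  rw [psiMinus, map_relabel_gen, psiMinus]; rfl

/-- A pair `ψ⁺_{kσ} ψ⁻_{k'σ'}` is even, hence central. [folklore] -/
theorem commute_psiPlus_mul_psiMinus (k k' : FreqMomentum L M) (σ σ' : Fin 2) (y : HubbardGrassmann L M) :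
    Commute (psiPlus k σ * psiMinus k' σ') y := by
  refine commute_of_mem_evenOdd_zero ℂ ?_ y
  have h := SetLike.mul_mem_graded (gen_mem_evenOdd_one ℂ ((k, σ), (0 : Fin 2)))
    (gen_mem_evenOdd_one ℂ ((k', σ'), (1 : Fin 2)))
  rw [show ((1 : ZMod 2) + 1) = 0 from rfl] at h
  exact h

variable [NeZero L]

/-- **The Hubbard vertex is spin-flip invariant** (swap the two even pairs and rename the momenta). [folklore] -/
theorem map_spinFlip_hubbardInteraction (β U : ℝ) :
    ExteriorAlgebra.map (relabel ℂ (spinFlipLabel (L := L) (M := M))) (hubbardInteraction L M β U) =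
      hubbardInteraction L M β U := by
  unfold hubbardInteraction
  rw [map_smul]
  congr 1
  simp only [map_sum]
  have hsum : ∀ k₁ k₂ k₃ k₄ : FreqMomentum L M,
      ExteriorAlgebra.map (relabel ℂ (spinFlipLabel (L := L) (M := M)))
        (if matsubaraInt M k₁.1 + matsubaraInt M k₃.1 = matsubaraInt M k₂.1 + matsubaraInt M k₄.1 ∧
            k₁.2 + k₃.2 = k₂.2 + k₄.2 then psiPlus k₁ 0 * psiMinus k₂ 0 * psiPlus k₃ 1 * psiMinus k₄ 1 else 0) =
        (if matsubaraInt M k₃.1 + matsubaraInt M k₁.1 = matsubaraInt M k₄.1 + matsubaraInt M k₂.1 ∧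
            k₃.2 + k₁.2 = k₄.2 + k₂.2 then psiPlus k₃ 0 * psiMinus k₄ 0 * psiPlus k₁ 1 * psiMinus k₂ 1 else 0) := by
    intro k₁ k₂ k₃ k₄
    have hiff : (matsubaraInt M k₁.1 + matsubaraInt M k₃.1 = matsubaraInt M k₂.1 + matsubaraInt M k₄.1 ∧
        k₁.2 + k₃.2 = k₂.2 + k₄.2) ↔ (matsubaraInt M k₃.1 + matsubaraInt M k₁.1 = matsubaraInt M k₄.1 + matsubaraInt M k₂.1 ∧
        k₃.2 + k₁.2 = k₄.2 + k₂.2) := by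
      rw [add_comm (matsubaraInt M k₁.1), add_comm (matsubaraInt M k₂.1), add_comm k₁.2, add_comm k₂.2]
    by_cases hc : matsubaraInt M k₁.1 + matsubaraInt M k₃.1 = matsubaraInt M k₂.1 + matsubaraInt M k₄.1 ∧
        k₁.2 + k₃.2 = k₂.2 + k₄.2
    · have r1 : (1 : Fin 2).rev = 0 := rfl
      have r0 : (0 : Fin 2).rev = 1 := rfl
      rw [if_pos hc, if_pos (hiff.1 hc), map_mul, map_mul, map_mul, map_spinFlip_psiPlus, map_spinFlip_psiMinus,
        map_spinFlip_psiPlus, map_spinFlip_psiMinus, r0, r1, mul_assoc, (commute_psiPlus_mul_psiMinus k₁ k₂ 1 1 _).eq,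
        ← mul_assoc]
    · rw [if_neg hc, if_neg (fun h => hc (hiff.2 h)), map_zero]
  simp only [hsum]
  -- rename the summation variables `(k₁, k₂, k₃, k₄) ↦ (k₃, k₄, k₁, k₂)`
  calc (∑ k₁ : FreqMomentum L M, ∑ k₂ : FreqMomentum L M, ∑ k₃ : FreqMomentum L M, ∑ k₄ : FreqMomentum L M,
        if matsubaraInt M k₃.1 + matsubaraInt M k₁.1 = matsubaraInt M k₄.1 + matsubaraInt M k₂.1 ∧
            k₃.2 + k₁.2 = k₄.2 + k₂.2 then psiPlus k₃ 0 * psiMinus k₄ 0 * psiPlus k₁ 1 * psiMinus k₂ 1 else 0)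
      = ∑ k₁ : FreqMomentum L M, ∑ k₃ : FreqMomentum L M, ∑ k₂ : FreqMomentum L M, ∑ k₄ : FreqMomentum L M,
        (if matsubaraInt M k₃.1 + matsubaraInt M k₁.1 = matsubaraInt M k₄.1 + matsubaraInt M k₂.1 ∧
            k₃.2 + k₁.2 = k₄.2 + k₂.2 then psiPlus k₃ 0 * psiMinus k₄ 0 * psiPlus k₁ 1 * psiMinus k₂ 1 else 0) :=
        Finset.sum_congr rfl fun k₁ _ => Finset.sum_comm
    _ = ∑ k₃ : FreqMomentum L M, ∑ k₁ : FreqMomentum L M, ∑ k₂ : FreqMomentum L M, ∑ k₄ : FreqMomentum L M,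
        (if matsubaraInt M k₃.1 + matsubaraInt M k₁.1 = matsubaraInt M k₄.1 + matsubaraInt M k₂.1 ∧
            k₃.2 + k₁.2 = k₄.2 + k₂.2 then psiPlus k₃ 0 * psiMinus k₄ 0 * psiPlus k₁ 1 * psiMinus k₂ 1 else 0) :=
        Finset.sum_comm
    _ = ∑ k₃ : FreqMomentum L M, ∑ k₁ : FreqMomentum L M, ∑ k₄ : FreqMomentum L M, ∑ k₂ : FreqMomentum L M,
        (if matsubaraInt M k₃.1 + matsubaraInt M k₁.1 = matsubaraInt M k₄.1 + matsubaraInt M k₂.1 ∧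
            k₃.2 + k₁.2 = k₄.2 + k₂.2 then psiPlus k₃ 0 * psiMinus k₄ 0 * psiPlus k₁ 1 * psiMinus k₂ 1 else 0) :=
        Finset.sum_congr rfl fun k₃ _ => Finset.sum_congr rfl fun k₁ _ => Finset.sum_comm
    _ = ∑ k₃ : FreqMomentum L M, ∑ k₄ : FreqMomentum L M, ∑ k₁ : FreqMomentum L M, ∑ k₂ : FreqMomentum L M,
        (if matsubaraInt M k₃.1 + matsubaraInt M k₁.1 = matsubaraInt M k₄.1 + matsubaraInt M k₂.1 ∧
            k₃.2 + k₁.2 = k₄.2 + k₂.2 then psiPlus k₃ 0 * psiMinus k₄ 0 * psiPlus k₁ 1 * psiMinus k₂ 1 else 0) :=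
        Finset.sum_congr rfl fun k₃ _ => Finset.sum_comm

/-- **The counterterm of every frame is spin-flip invariant.** [folklore] -/
theorem map_spinFlip_counterQuadratic (β : ℝ) (K : TrigPolyC4v) :
    ExteriorAlgebra.map (relabel ℂ (spinFlipLabel (L := L) (M := M))) (counterQuadratic L M β K) =
      counterQuadratic L M β K := by
  unfold counterQuadratic
  simp only [map_sum, map_smul, map_mul, map_spinFlip_psiPlus, map_spinFlip_psiMinus]
  exact Finset.sum_congr rfl fun k _ => Fintype.sum_equiv Fin.revPerm _ _ fun σ => rfl

/-- **The countertermed effective action at zero seed is spin-flip invariant**, for every `U`, `μ`, frame,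
scale and `(L, M, β)`. [folklore] -/
theorem map_spinFlip_hubbardEffectiveActionCT (β U μ : ℝ) (K : TrigPolyC4v) (Λ : ℝ) :
    ExteriorAlgebra.map (relabel ℂ (spinFlipLabel (L := L) (M := M))) (hubbardEffectiveActionCT L M β U μ 0 K Λ) =
      hubbardEffectiveActionCT L M β U μ 0 K Λ := by
  rw [hubbardEffectiveActionCT]
  refine map_relabel_effAction ℂ (fun X Y => hubbardCovAboveCT_spinFlip β μ K Λ X Y)
    (isNilpotent_hubbardInteractionCT L M β U K) ?_
  rw [hubbardInteractionCT, map_add, map_spinFlip_hubbardInteraction, map_spinFlip_counterQuadratic]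

/-- Vertex functions of the CT effective action are spin-flip invariant. [folklore] -/
theorem vertexFn_hubbardCT_spinFlip (β U μ : ℝ) (K : TrigPolyC4v) (Λ : ℝ) (m : ℕ) (X : Fin m → HubbardFieldIdx L M) :
    vertexFn L M β (hubbardEffectiveActionCT L M β U μ 0 K Λ) m (fun i => spinFlipLabel (X i)) =
      vertexFn L M β (hubbardEffectiveActionCT L M β U μ 0 K Λ) m X := by
  rw [vertexFn, vertexFn, kernel_comp_perm_of_map_relabel_eq ℂ (map_spinFlip_hubbardEffectiveActionCT β U μ K Λ)]

/-- **The self-energy of the CT effective action does not depend on the spin.** [folklore] -/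
theorem selfEnergy_hubbardCT_spin (β U μ : ℝ) (K : TrigPolyC4v) (Λ : ℝ) (p : FreqMomentum L M) (σ : Fin 2) :
    selfEnergy L M β (hubbardEffectiveActionCT L M β U μ 0 K Λ) p σ.rev =
      selfEnergy L M β (hubbardEffectiveActionCT L M β U μ 0 K Λ) p σ := by
  have h := vertexFn_hubbardCT_spinFlip β U μ K Λ 2 ![((p, σ), 0), ((p, σ), 1)]
  have hX : (fun i => spinFlipLabel (![((p, σ), 0), ((p, σ), 1)] i)) = ![((p, σ.rev), 0), ((p, σ.rev), 1)] := by
    funext i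
    fin_cases i <;> rfl
  rw [hX] at h
  rw [selfEnergy, selfEnergy]
  exact h

variable [NeZero M]

/-- **The field strengths of the CT effective action do not depend on the spin**: `z(k⃗, ↓) = z(k⃗, ↑)`, so
clause (0c) need only be certified for one spin. [folklore] -/
theorem fieldStrengthSpin_hubbardCT_spin (β U μ : ℝ) (K : TrigPolyC4v) (Λ : ℝ) (k : TorusSite 2 L) (σ : Fin 2) :
    fieldStrengthSpin L M β (hubbardEffectiveActionCT L M β U μ 0 K Λ) k σ.rev =
      fieldStrengthSpin L M β (hubbardEffectiveActionCT L M β U μ 0 K Λ) k σ := by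
  simp only [fieldStrengthSpin, selfEnergy_hubbardCT_spin]

/-- Hence the spin-averaged field strength is the field strength at either spin. [folklore] -/
theorem fieldStrength_hubbardCT_eq_spin (β U μ : ℝ) (K : TrigPolyC4v) (Λ : ℝ) (k : TorusSite 2 L) :
    fieldStrength L M β (hubbardEffectiveActionCT L M β U μ 0 K Λ) k =
      fieldStrengthSpin L M β (hubbardEffectiveActionCT L M β U μ 0 K Λ) k 0 := by
  rw [fieldStrength, show (1 : Fin 2) = (0 : Fin 2).rev from rfl, fieldStrengthSpin_hubbardCT_spin]
  ring

/-- **The Cooper amplitude equals its spin-exchanged form**: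
`𝒞(k⃗, k⃗') = 𝒱₄(ψ̂⁺_{(ω₀,k⃗')↓}, ψ̂⁺_{(-ω₀,-k⃗')↑}, ψ̂⁻_{(-ω₀,-k⃗)↑}, ψ̂⁻_{(ω₀,k⃗)↓})`. [folklore] -/
theorem cooperAmplitude_hubbardCT_spinFlip (β U μ : ℝ) (K : TrigPolyC4v) (Λ : ℝ) (k k' : TorusSite 2 L) :
    vertexFn L M β (hubbardEffectiveActionCT L M β U μ 0 K Λ) 4
      ![(((omega0 M, k'), 1), 0), ((FreqMomentum.neg (omega0 M, k'), 0), 0),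
        ((FreqMomentum.neg (omega0 M, k), 0), 1), (((omega0 M, k), 1), 1)] =
      cooperAmplitude L M β (hubbardEffectiveActionCT L M β U μ 0 K Λ) k k' := by
  have h := vertexFn_hubbardCT_spinFlip β U μ K Λ 4
    ![(((omega0 M, k'), 0), 0), ((FreqMomentum.neg (omega0 M, k'), 1), 0),
      ((FreqMomentum.neg (omega0 M, k), 1), 1), (((omega0 M, k), 0), 1)]
  have hX : (fun i => spinFlipLabel (![(((omega0 M, k'), 0), 0), ((FreqMomentum.neg (omega0 M, k'), 1), 0),
      ((FreqMomentum.neg (omega0 M, k), 1), 1), (((omega0 M, k), 0), 1)] i)) =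
      ![(((omega0 M, k'), 1), 0), ((FreqMomentum.neg (omega0 M, k'), 0), 0),
        ((FreqMomentum.neg (omega0 M, k), 0), 1), (((omega0 M, k), 1), 1)] := by
    funext i
    fin_cases i <;> rfl
  rw [hX] at h
  rw [cooperAmplitude]
  exact h

end SpinFlip

/-! ## §12 (cycle 2) `C₄` covariance of the particle–hole (Stoner) clause -/

section SupRayleigh

variable {m : Type*} [Fintype m]

/-- **The top Rayleigh quotient is invariant under a simultaneous permutation of rows and columns.** [folklore] -/
theorem supRayleigh_submatrix_equiv (A : Matrix m m ℂ) (σ : Equiv.Perm m) :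
    (A.submatrix σ σ).supRayleigh = A.supRayleigh := by
  classical
  unfold Matrix.supRayleigh
  -- reindex the unit vectors: `v ↦ v ∘ σ⁻¹`
  have hunit : ∀ v : m → ℂ, star (v ∘ σ.symm) ⬝ᵥ (v ∘ σ.symm) = star v ⬝ᵥ v := fun v => by
    simp only [dotProduct, Pi.star_apply, Function.comp_apply]
    exact Equiv.sum_comp σ.symm (fun i => star (v i) * v i)
  let g : {v : m → ℂ // star v ⬝ᵥ v = 1} → {v : m → ℂ // star v ⬝ᵥ v = 1} :=
    fun v => ⟨v.1 ∘ σ.symm, (hunit v.1).trans v.2⟩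
  have hg : Function.Surjective g := fun w => ⟨⟨w.1 ∘ σ, by
      have := hunit (w.1 ∘ σ)
      simp only [Function.comp_assoc, Equiv.self_comp_symm, Function.comp_id] at this
      rw [← this, w.2]⟩, by
      apply Subtype.ext
      funext i
      simp [g]⟩
  have hval : ∀ v : {v : m → ℂ // star v ⬝ᵥ v = 1},
      (star (v : m → ℂ) ⬝ᵥ (A.submatrix σ σ) *ᵥ (v : m → ℂ)).re = (star ((g v) : m → ℂ) ⬝ᵥ A *ᵥ ((g v) : m → ℂ)).re := by
    intro v
    show (star (v : m → ℂ) ⬝ᵥ (A.submatrix σ σ) *ᵥ (v : m → ℂ)).re =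
      (star ((v : m → ℂ) ∘ σ.symm) ⬝ᵥ A *ᵥ ((v : m → ℂ) ∘ σ.symm)).re
    congr 1
    simp only [dotProduct, Matrix.mulVec, Matrix.submatrix_apply, Pi.star_apply, Function.comp_apply]
    symm
    rw [← Equiv.sum_comp σ]
    refine Finset.sum_congr rfl fun i _ => ?_
    rw [Equiv.symm_apply_apply, ← Equiv.sum_comp σ]
    simp only [Equiv.symm_apply_apply]
  simp_rw [hval]
  exact hg.iSup_comp (fun w : {v : m → ℂ // star v ⬝ᵥ v = 1} => (star (w : m → ℂ) ⬝ᵥ A *ᵥ (w : m → ℂ)).re)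

end SupRayleigh

section Stoner

variable {L M : ℕ} [NeZero L] [NeZero M]

/-- **The particle–hole vertices of the CT effective action are rotation covariant.** [folklore] -/
theorem phVertex_hubbardCT_rotSite (β U μ : ℝ) (K : TrigPolyC4v) (Λ : ℝ) (q k k' : TorusSite 2 L) (σ σ' : Fin 2) :
    phVertex L M β (hubbardEffectiveActionCT L M β U μ 0 K Λ) (rotSite q) (rotSite k) (rotSite k') σ σ' =
      phVertex L M β (hubbardEffectiveActionCT L M β U μ 0 K Λ) q k k' σ σ' := by
  have h := vertexFn_hubbardCT_rotLabel β U μ K Λ 4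
    ![(((omega0 M, k + q), σ), 0), (((omega0 M, k), σ), 1), (((omega0 M, k'), σ'), 0), (((omega0 M, k' + q), σ'), 1)]
  have hX : (fun i => rotLabel (![(((omega0 M, k + q), σ), 0), (((omega0 M, k), σ), 1), (((omega0 M, k'), σ'), 0),
      (((omega0 M, k' + q), σ'), 1)] i)) =
      ![(((omega0 M, rotSite k + rotSite q), σ), 0), (((omega0 M, rotSite k), σ), 1), (((omega0 M, rotSite k'), σ'), 0),
        (((omega0 M, rotSite k' + rotSite q), σ'), 1)] := by
    funext i
    fin_cases i
    · show (((omega0 M, rotSite (k + q)), σ), (0 : Fin 2)) = _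
      rw [rotSite_add]; rfl
    · rfl
    · rfl
    · show (((omega0 M, rotSite (k' + q)), σ'), (1 : Fin 2)) = _
      rw [rotSite_add]; rfl
  rw [hX] at h
  rw [phVertex, phVertex]
  exact h

/-- The charge vertex is rotation covariant. [folklore] -/
theorem chargeVertex_hubbardCT_rotSite (β U μ : ℝ) (K : TrigPolyC4v) (Λ : ℝ) (q k k' : TorusSite 2 L) :
    chargeVertex L M β (hubbardEffectiveActionCT L M β U μ 0 K Λ) (rotSite q) (rotSite k) (rotSite k') =
      chargeVertex L M β (hubbardEffectiveActionCT L M β U μ 0 K Λ) q k k' := by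
  simp only [chargeVertex, phVertex_hubbardCT_rotSite]

/-- The spin vertex is rotation covariant. [folklore] -/
theorem spinVertex_hubbardCT_rotSite (β U μ : ℝ) (K : TrigPolyC4v) (Λ : ℝ) (q k k' : TorusSite 2 L) :
    spinVertex L M β (hubbardEffectiveActionCT L M β U μ 0 K Λ) (rotSite q) (rotSite k) (rotSite k') =
      spinVertex L M β (hubbardEffectiveActionCT L M β U μ 0 K Λ) q k k' := by
  simp only [spinVertex, phVertex_hubbardCT_rotSite]

/-- **The scale-`Λ` particle–hole bubble of the CT effective action is rotation covariant.** [folklore] -/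
theorem phBubble_hubbardCT_rotSite (β U μ : ℝ) (K : TrigPolyC4v) (Λ Λ' : ℝ) (q k : TorusSite 2 L) :
    phBubble L M β (nambuXiCT L μ K) Λ' (hubbardEffectiveActionCT L M β U μ 0 K Λ) (rotSite q) (rotSite k) =
      phBubble L M β (nambuXiCT L μ K) Λ' (hubbardEffectiveActionCT L M β U μ 0 K Λ) q k := by
  rw [phBubble, phBubble, ← rotSite_add, nambuXiCT_rotSite, nambuXiCT_rotSite, fieldStrength_hubbardCT_rotSite,
    fieldStrength_hubbardCT_rotSite]

/-- The transfer shell at the rotated transfer is the rotated transfer shell. [folklore] -/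
theorem mem_transferShell_rotSite (μ : ℝ) (K : TrigPolyC4v) (Λ' : ℝ) (q k : TorusSite 2 L) :
    rotSite k ∈ transferShell L (nambuXiCT L μ K) Λ' (rotSite q) ↔ k ∈ transferShell L (nambuXiCT L μ K) Λ' q := by
  simp only [transferShell, Finset.mem_filter, mem_momentumShell, ← rotSite_add, nambuXiCT_rotSite]

/-- **The Stoner matrix at the rotated transfer is the `rot`-reindexed Stoner matrix** (charge). [folklore] -/
theorem stonerMatrix_charge_hubbardCT_rotSite (β U μ : ℝ) (K : TrigPolyC4v) (Λ Λ' : ℝ) (q : TorusSite 2 L) :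
    stonerMatrix L (chargeVertex L M β (hubbardEffectiveActionCT L M β U μ 0 K Λ) (rotSite q))
        (phBubble L M β (nambuXiCT L μ K) Λ' (hubbardEffectiveActionCT L M β U μ 0 K Λ) (rotSite q))
        (transferShell L (nambuXiCT L μ K) Λ' (rotSite q)) =
      (stonerMatrix L (chargeVertex L M β (hubbardEffectiveActionCT L M β U μ 0 K Λ) q)
        (phBubble L M β (nambuXiCT L μ K) Λ' (hubbardEffectiveActionCT L M β U μ 0 K Λ) q)
        (transferShell L (nambuXiCT L μ K) Λ' q)).submatrix rotSiteEquiv.symm rotSiteEquiv.symm := by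
  ext k k'
  have hk : k = rotSite (rotSiteEquiv.symm k) := (rotSiteEquiv.apply_symm_apply k).symm
  have hk' : k' = rotSite (rotSiteEquiv.symm k') := (rotSiteEquiv.apply_symm_apply k').symm
  simp only [stonerMatrix, Matrix.of_apply, Matrix.submatrix_apply]
  conv_lhs => rw [hk, hk']
  simp only [mem_transferShell_rotSite, phBubble_hubbardCT_rotSite, chargeVertex_hubbardCT_rotSite]

/-- **The Stoner matrix at the rotated transfer is the `rot`-reindexed Stoner matrix** (spin). [folklore] -/
theorem stonerMatrix_spin_hubbardCT_rotSite (β U μ : ℝ) (K : TrigPolyC4v) (Λ Λ' : ℝ) (q : TorusSite 2 L) :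
    stonerMatrix L (spinVertex L M β (hubbardEffectiveActionCT L M β U μ 0 K Λ) (rotSite q))
        (phBubble L M β (nambuXiCT L μ K) Λ' (hubbardEffectiveActionCT L M β U μ 0 K Λ) (rotSite q))
        (transferShell L (nambuXiCT L μ K) Λ' (rotSite q)) =
      (stonerMatrix L (spinVertex L M β (hubbardEffectiveActionCT L M β U μ 0 K Λ) q)
        (phBubble L M β (nambuXiCT L μ K) Λ' (hubbardEffectiveActionCT L M β U μ 0 K Λ) q)
        (transferShell L (nambuXiCT L μ K) Λ' q)).submatrix rotSiteEquiv.symm rotSiteEquiv.symm := by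
  ext k k'
  have hk : k = rotSite (rotSiteEquiv.symm k) := (rotSiteEquiv.apply_symm_apply k).symm
  have hk' : k' = rotSite (rotSiteEquiv.symm k') := (rotSiteEquiv.apply_symm_apply k').symm
  simp only [stonerMatrix, Matrix.of_apply, Matrix.submatrix_apply]
  conv_lhs => rw [hk, hk']
  simp only [mem_transferShell_rotSite, phBubble_hubbardCT_rotSite, spinVertex_hubbardCT_rotSite]

/-- **The charge Stoner product of the CT effective action is rotation invariant in the transfer.** [folklore] -/
theorem stonerCharge_hubbardCT_rotSite (β U μ : ℝ) (K : TrigPolyC4v) (Λ Λ' : ℝ) (q : TorusSite 2 L) :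
    stonerCharge L M β (nambuXiCT L μ K) Λ' (hubbardEffectiveActionCT L M β U μ 0 K Λ) (rotSite q) =
      stonerCharge L M β (nambuXiCT L μ K) Λ' (hubbardEffectiveActionCT L M β U μ 0 K Λ) q := by
  rw [stonerCharge, stonerCharge, stonerMatrix_charge_hubbardCT_rotSite, supRayleigh_submatrix_equiv]

/-- **The spin Stoner product of the CT effective action is rotation invariant in the transfer.** [folklore] -/
theorem stonerSpin_hubbardCT_rotSite (β U μ : ℝ) (K : TrigPolyC4v) (Λ Λ' : ℝ) (q : TorusSite 2 L) :
    stonerSpin L M β (nambuXiCT L μ K) Λ' (hubbardEffectiveActionCT L M β U μ 0 K Λ) (rotSite q) =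
      stonerSpin L M β (nambuXiCT L μ K) Λ' (hubbardEffectiveActionCT L M β U μ 0 K Λ) q := by
  rw [stonerSpin, stonerSpin, stonerMatrix_spin_hubbardCT_rotSite, supRayleigh_submatrix_equiv]

end Stoner

end Summit.HubbardSuperconductivity.HubbardSuperconductivity.Cruxes.CapRgSymmetricCertificatePinned.Disproof

end
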